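import Literature.Geometry.Lorentzian.DiagonalChartMetric
import Literature.Geometry.Lorentzian.SecondFundamentalFormLift
import Literature.Geometry.Lorentzian.TrappedSurface
import Literature.Geometry.Lorentzian.IsometryProofs
import Literature.Geometry.Lorentzian.PseudoRiemannianMetricProofs
import Literature.Geometry.Lorentzian.MetricNormSq
import Literature.Topology.FourManifolds.ImmersionCriterion
import Mathlib.Geometry.Manifold.Instances.Sphere
import Mathlib.LinearAlgebra.Matrix.NonsingularInverse
import HarnessLib

/-!
# Trapped round spheres in homogeneous slices of diagonal chart metrics (Kasner-type regions)

Support file (everything proved, no named facts) for the explicit vacuum spacetime of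
`Literature.Geometry.Lorentzian.christodoulou_trapped_surface_formation_holds`.

Let `g` be the diagonal chart metric of components `(g₀, g₁, g₂, g₃)` on `V : Opens E4`
(`OpensChart.diagLorentz`), time-oriented by `−∂₀` (the future is the direction of *decreasing*
`y⁰`, towards a Kasner-type singularity), and suppose that on an open set `W ⊆ V` the components
depend on `t = y⁰` alone: `gᵢ(y) = κᵢ(y⁰)`, with `κᵢ` differentiable at `t_c` with derivative
`κ̇ᵢ`. In the homogeneous slice `{y⁰ = t_c}` (flat metric `h = ∑ⱼ κⱼ(t_c) dyʲ²`, `j = 1,2,3`)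
consider the **round `h`-sphere of radius `ℓ`** about a centre `c`,
`f(n) = (t_c, cⱼ + (ℓ/√κⱼ) nⱼ)`, `n ∈ S² ⊂ E3` (`Kasner.sphereMap`, `Kasner.SliceData.f`). This file
proves that `f` is a closed **trapped surface** (`LorentzianMetric.IsTrappedSurface`, Penrose 1965)
as soon as `4 √(−κ₀(t_c)) < ℓ · ∑ⱼ (κ̇ⱼ/κⱼ)(t_c) (1 − nⱼ²)` for every unit vector `n`
(`Kasner.SliceData.isTrappedSurface`):
both null expansions are
`θ± = ± 2/ℓ − ½ (−κ₀)^{-1/2} ∑ⱼ (κ̇ⱼ/κⱼ)(1 − nⱼ²) < 0`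
(the slice has second fundamental form `K = −½(−κ₀)^{-1/2} ∂ₜh` with respect to the future unit
normal `−(−κ₀)^{-1/2}∂₀`, the round sphere has mean curvature `2/ℓ`, and
`tr_S K = ∑ⱼ kⱼ (1 − nⱼ²)`; compare Hawking–Ellis 1973, §4.2 and §9.2, Wald 1984, §9.5, and, for
trapped surfaces in anisotropic Kasner/Bianchi-I universes, Senovilla, *Trapped surfaces*,
Int. J. Mod. Phys. D 20 (2011) 2139, §§4–5). Every null normal pair of `f` is
`(a L₊, a⁻¹ L₋)` or its swap with `a > 0` a `C¹` function (`Kasner.SliceData.pair_local`), so the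
definition's universal quantifier over null normal pairs reduces to the canonical pair
`L± = −(−κ₀)^{-1/2} ∂₀ ± ν̂`, `ν̂ = (nⱼ/√κⱼ)ⱼ`.

## References

* R. Penrose, Phys. Rev. Lett. 14 (1965) 57–59 (closed trapped surfaces). [Penrose1965]
* S. W. Hawking, G. F. R. Ellis, *The large scale structure of space-time*, CUP 1973, §4.2, §9.2.
  [HawkingEllis1973]
* B. O'Neill, *Semi-Riemannian geometry*, 1983, Ch. 4, Lemma 4.1 ff. (induced connection, shape
  tensor), Ch. 5, Lemma 5.26 ff. (causal character). [ONeill1983]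
* J. M. M. Senovilla, *Trapped surfaces*, Int. J. Mod. Phys. D 20 (2011) 2139–2168, §§4–5.
-/

noncomputable section

set_option maxSynthPendingDepth 3

open Set Filter TopologicalSpace Bundle Metric Module Function
open scoped Topology ContDiff Manifold RealInnerProductSpace

namespace Literature.Geometry.Lorentzian

namespace Kasner

open MetricCoord OpensChart

/-! ### Linear algebra in `E3`: column sums of a matrix with orthonormal rows -/

/-- **Rows orthonormal ⇒ columns orthonormal** (`B Bᵀ = 1 ⇒ Bᵀ B = 1`, Mathlib's
`Matrix.mul_eq_one_comm`), read off on the diagonal: for three orthonormal vectors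
`w₀, w₁, w₂ ∈ E3`, `∑_c (w_c)ⱼ² = 1` for each coordinate `j`. [folklore] -/
theorem sum_sq_coord_eq_one_of_orthonormal (w : Fin 3 → E3)
    (hon : ∀ a b : Fin 3, ⟪w a, w b⟫ = if a = b then (1 : ℝ) else 0) (j : Fin 3) :
    ∑ c : Fin 3, (w c j) ^ 2 = 1 := by
  set B : Matrix (Fin 3) (Fin 3) ℝ := Matrix.of fun c k ↦ w c k with hB
  have hBBt : B * B.transpose = 1 := by
    ext a b
    rw [Matrix.mul_apply, Matrix.one_apply]
    have h := hon a b
    rw [PiLp.inner_apply] at h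
    simp only [RCLike.inner_apply, conj_trivial] at h
    rw [← h]
    refine Finset.sum_congr rfl fun k _ ↦ ?_
    simp [B, Matrix.transpose_apply, mul_comm]
  have hBtB : B.transpose * B = 1 := mul_eq_one_comm.1 hBBt
  have hjj := congrArg (fun M : Matrix (Fin 3) (Fin 3) ℝ ↦ M j j) hBtB
  simp only [Matrix.mul_apply, Matrix.transpose_apply, Matrix.one_apply_eq, B, Matrix.of_apply]
    at hjj
  rw [← hjj]
  exact Finset.sum_congr rfl fun c _ ↦ by ring

/-- **Weighted trace over an orthonormal triple**: for orthonormal `w₀, w₁, w₂ ∈ E3` and weights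
`rⱼ`, `∑_c ∑ⱼ rⱼ (w_c)ⱼ² = ∑ⱼ rⱼ` (the trace of `diag(r)` computed in the frame `w`).
[folklore] -/
theorem sum_weighted_sq_eq_of_orthonormal (w : Fin 3 → E3)
    (hon : ∀ a b : Fin 3, ⟪w a, w b⟫ = if a = b then (1 : ℝ) else 0) (r : Fin 3 → ℝ) :
    ∑ c : Fin 3, ∑ j : Fin 3, r j * (w c j) ^ 2 = ∑ j : Fin 3, r j := by
  rw [Finset.sum_comm]
  refine Finset.sum_congr rfl fun j _ ↦ ?_
  rw [← Finset.mul_sum, sum_sq_coord_eq_one_of_orthonormal w hon j, mul_one]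

/-- The inner product of `E3` in coordinates. [folklore] -/
theorem inner_eq_sum (u v : E3) : ⟪u, v⟫ = ∑ j : Fin 3, u j * v j := by
  rw [PiLp.inner_apply]
  refine Finset.sum_congr rfl fun j _ ↦ ?_
  simp [mul_comm]

/-! ### The metric trace in an orthogonal frame (local copy of the frame formula) -/

section Trace

variable {EB : Type*} [NormedAddCommGroup EB] [NormedSpace ℝ EB] {HB : Type*}
  [TopologicalSpace HB] {IB : ModelWithCorners ℝ EB HB} {B : Type*} [TopologicalSpace B]
  [ChartedSpace HB B] {nB : ℕ∞ω} {F : Type*} [NormedAddCommGroup F] [NormedSpace ℝ F]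
  [FiniteDimensional ℝ F] {E : B → Type*} [TopologicalSpace (TotalSpace F E)]
  [∀ b, TopologicalSpace (E b)] [∀ b, AddCommGroup (E b)] [∀ b, Module ℝ (E b)]
  [FiberBundle F E] [VectorBundle ℝ F E]

/-- **The metric trace in an orthogonal frame**: `tr_g T = ∑ᵢ T(eᵢ, eᵢ)/g(eᵢ, eᵢ)` for a
`g_b`-orthogonal basis `e` of non-null vectors (O'Neill 1983, Ch. 3, pp. 60–61; the frame formula
of `RicciFlowScalarCurvatureComparison.trace_eq_sum_div_of_isOrthoᵢ`, copied to keep the import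
closure small). [cite: ONeill1983, Ch. 3, pp. 60–61] -/
theorem trace_eq_sum_div (g : PseudoRiemannianMetric IB nB F E) (b : B) {ι : Type*} [Fintype ι]
    [DecidableEq ι] (e : Basis ι ℝ (E b)) (he : (g.toBilinForm b).IsOrthoᵢ e)
    (hc : ∀ i, g.val b (e i) (e i) ≠ 0) (T : LinearMap.BilinForm ℝ (E b)) :
    g.trace b T = ∑ i, T (e i) (e i) / g.val b (e i) (e i) := by
  classical
  rw [PseudoRiemannianMetric.trace, LinearMap.trace_eq_matrix_trace ℝ e, Matrix.trace]
  refine Finset.sum_congr rfl fun i _ ↦ ?_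
  rw [Matrix.diag_apply, LinearMap.toMatrix_apply, repr_eq_div_of_isOrthoᵢ e he hc,
    LinearMap.comp_apply]
  simp

end Trace

/-! ### The data: components depending on `t` alone near a slice, the round sphere -/

/-- The scaling factors `ρⱼ = ℓ / √κⱼ₊₁` turning the unit sphere into the round `h`-sphere of radius
`ℓ` in the slice metric `h = ∑ κⱼ₊₁ dyʲ²`. [cite: HawkingEllis1973, §9.2] -/
def rho (κ : Fin 4 → ℝ) (ℓ : ℝ) (j : Fin 3) : ℝ := ℓ / Real.sqrt (κ j.succ)

/-- The `h`-unit outward normal direction as a linear map of the position vector: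
`ν̂(n) = ∑ⱼ (nⱼ/√κⱼ₊₁) ∂ⱼ₊₁`. [cite: HawkingEllis1973, §9.2] -/
def normalCLM (κ : Fin 4 → ℝ) : E3 →L[ℝ] E4 :=
  ∑ j : Fin 3, (Real.sqrt (κ j.succ))⁻¹ •
    (EuclideanSpace.proj j : E3 →L[ℝ] ℝ).smulRight (eb j.succ : E4)

/-- The differential of the sphere map: `D u = ∑ⱼ ρⱼ uⱼ ∂ⱼ₊₁ = ℓ ν̂(u)`. [cite: HawkingEllis1973, §9.2] -/
def sphereDiff (κ : Fin 4 → ℝ) (ℓ : ℝ) : E3 →L[ℝ] E4 := ℓ • normalCLM κ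

/-- **The round coordinate sphere** of `h`-radius `ℓ` about the centre `(t_c, c)` in the slice
`{y⁰ = t_c}`, as an affine map of the position vector `n ∈ E3`:
`n ↦ (t_c, c₀ + ρ₀ n₀, c₁ + ρ₁ n₁, c₂ + ρ₂ n₂)`. [cite: HawkingEllis1973, §9.2] -/
def spherePt (κ : Fin 4 → ℝ) (ℓ tc : ℝ) (c : E3) (n : E3) : E4 :=
  E4.ofTimeSpace tc c + sphereDiff κ ℓ n

section Sphere

variable {κ : Fin 4 → ℝ} {ℓ tc : ℝ} {c : E3}

/-- Components of `ν̂(u)`: time component `0`. [folklore] -/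
@[simp]
theorem normalCLM_apply_zero (u : E3) : normalCLM κ u 0 = 0 := by
  simp [normalCLM, Fin.succ_ne_zero]

/-- Components of `ν̂(u)`: spatial components `uⱼ/√κⱼ₊₁`. [folklore] -/
@[simp]
theorem normalCLM_apply_succ (u : E3) (j : Fin 3) :
    normalCLM κ u j.succ = (Real.sqrt (κ j.succ))⁻¹ * u j := by
  simp only [normalCLM, FunLike.coe_sum, Finset.sum_apply, FunLike.coe_smul, Pi.smul_apply,
    ContinuousLinearMap.smulRight_apply]
  rw [WithLp.ofLp_sum, Finset.sum_apply, Finset.sum_eq_single j]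
  · simp
  · intro k _ hk
    simp [Fin.succ_inj, Ne.symm hk]
  · intro h; exact absurd (Finset.mem_univ j) h

/-- Components of `D u`: time component `0`. [folklore] -/
@[simp]
theorem sphereDiff_apply_zero (u : E3) : sphereDiff κ ℓ u 0 = 0 := by
  simp [sphereDiff]

/-- Components of `D u`: `ρⱼ uⱼ`. [folklore] -/
@[simp]
theorem sphereDiff_apply_succ (u : E3) (j : Fin 3) :
    sphereDiff κ ℓ u j.succ = rho κ ℓ j * u j := by
  simp [sphereDiff, rho, div_eq_mul_inv, mul_assoc]

/-- Components of the sphere point: `y⁰ = t_c`. [folklore] -/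
@[simp]
theorem spherePt_apply_zero (n : E3) : spherePt κ ℓ tc c n 0 = tc := by
  simp [spherePt]

/-- Components of the sphere point: `yʲ⁺¹ = cⱼ + ρⱼ nⱼ`. [folklore] -/
@[simp]
theorem spherePt_apply_succ (n : E3) (j : Fin 3) :
    spherePt κ ℓ tc c n j.succ = c j + rho κ ℓ j * n j := by
  simp [spherePt]

/-- The sphere map is affine: its derivative is `D` everywhere. [folklore] -/
theorem hasFDerivAt_spherePt (n : E3) : HasFDerivAt (spherePt κ ℓ tc c) (sphereDiff κ ℓ) n := by
  have h := ((sphereDiff κ ℓ).hasFDerivAt (x := n)).const_add (E4.ofTimeSpace tc c)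
  exact h

/-- The sphere map is smooth. [folklore] -/
theorem contDiff_spherePt : ContDiff ℝ ∞ (spherePt κ ℓ tc c) :=
  contDiff_const.add (sphereDiff κ ℓ).contDiff

/-! ### Algebra of the diagonal form on the sphere vectors -/

/-- **The induced metric is `ℓ²` times the round metric**: `G(D u, D u') = ℓ² ⟪u, u'⟫` for the
diagonal form of coefficients `κ` (`κⱼ₊₁ ρⱼ² = ℓ²`). [cite: HawkingEllis1973, §9.2] -/
theorem diagForm_sphereDiff (hpos : ∀ j : Fin 3, 0 < κ j.succ) (u u' : E3) :
    diagForm κ (sphereDiff κ ℓ u) (sphereDiff κ ℓ u') = ℓ ^ 2 * ⟪u, u'⟫ := by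
  rw [diagForm_apply, Fin.sum_univ_four, inner_eq_sum, Fin.sum_univ_three]
  simp only [sphereDiff_apply_zero, mul_zero,
    show (1 : Fin 4) = (0 : Fin 3).succ from rfl, show (2 : Fin 4) = (1 : Fin 3).succ from rfl,
    show (3 : Fin 4) = (2 : Fin 3).succ from rfl, sphereDiff_apply_succ]
  have hk : ∀ j : Fin 3, κ j.succ * (rho κ ℓ j * u j * (rho κ ℓ j * u' j)) = ℓ ^ 2 * (u j * u' j) := by
    intro j
    have hs : Real.sqrt (κ j.succ) ^ 2 = κ j.succ := Real.sq_sqrt (hpos j).le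
    have hne : Real.sqrt (κ j.succ) ≠ 0 := (Real.sqrt_pos.mpr (hpos j)).ne'
    rw [rho]
    field_simp
    rw [hs]
    ring
  rw [zero_add, hk 0, hk 1, hk 2]
  ring

/-- **The normal direction is orthogonal to the tangent directions**: `G(a∂₀ + s ν̂(n), D u) =
s ℓ ⟪n, u⟫`. [cite: HawkingEllis1973, §9.2] -/
theorem diagForm_normal_sphereDiff (hpos : ∀ j : Fin 3, 0 < κ j.succ) (a s : ℝ) (n u : E3) :
    diagForm κ (a • (eb 0 : E4) + s • normalCLM κ n) (sphereDiff κ ℓ u) = s * ℓ * ⟪n, u⟫ := by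
  rw [diagForm_apply, Fin.sum_univ_four, inner_eq_sum, Fin.sum_univ_three]
  simp only [sphereDiff_apply_zero, mul_zero,
    show (1 : Fin 4) = (0 : Fin 3).succ from rfl, show (2 : Fin 4) = (1 : Fin 3).succ from rfl,
    show (3 : Fin 4) = (2 : Fin 3).succ from rfl, sphereDiff_apply_succ, PiLp.add_apply,
    PiLp.smul_apply, smul_eq_mul, normalCLM_apply_succ, eb_apply, Fin.succ_ne_zero, if_false]
  have hk : ∀ j : Fin 3, κ j.succ * ((0 + s * ((Real.sqrt (κ j.succ))⁻¹ * n j)) *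
      (rho κ ℓ j * u j)) = s * ℓ * (n j * u j) := by
    intro j
    have hs : Real.sqrt (κ j.succ) ^ 2 = κ j.succ := Real.sq_sqrt (hpos j).le
    have hne : Real.sqrt (κ j.succ) ≠ 0 := (Real.sqrt_pos.mpr (hpos j)).ne'
    rw [rho]
    field_simp
    rw [hs]
    ring
  rw [zero_add, hk 0, hk 1, hk 2]
  ring

/-- **Scalar products of the null normals**: for `L_s = a ∂₀ + s ν̂(n)` with `κ₀ a² = −1` and
`|n| = 1`, `G(L_s, L_{s'}) = −1 + s s'`. [cite: HawkingEllis1973, §9.2] -/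
theorem diagForm_normal_normal (hpos : ∀ j : Fin 3, 0 < κ j.succ) (a s s' : ℝ) (n : E3)
    (hn : ‖n‖ = 1) (ha : κ 0 * a ^ 2 = -1) :
    diagForm κ (a • (eb 0 : E4) + s • normalCLM κ n) (a • (eb 0 : E4) + s' • normalCLM κ n) =
      -1 + s * s' := by
  have hnn : ∑ j : Fin 3, n j * n j = 1 := by
    rw [← inner_eq_sum, real_inner_self_eq_norm_sq, hn, one_pow]
  rw [diagForm_apply, Fin.sum_univ_four]
  simp only [show (1 : Fin 4) = (0 : Fin 3).succ from rfl, show (2 : Fin 4) = (1 : Fin 3).succ from rfl,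
    show (3 : Fin 4) = (2 : Fin 3).succ from rfl, PiLp.add_apply, PiLp.smul_apply, smul_eq_mul,
    normalCLM_apply_succ, normalCLM_apply_zero, eb_apply, Fin.succ_ne_zero, if_false, if_true,
    mul_zero, add_zero, mul_one]
  have hk : ∀ j : Fin 3, κ j.succ * ((0 + s * ((Real.sqrt (κ j.succ))⁻¹ * n j)) *
      (0 + s' * ((Real.sqrt (κ j.succ))⁻¹ * n j))) = s * s' * (n j * n j) := by
    intro j
    have hs : Real.sqrt (κ j.succ) ^ 2 = κ j.succ := Real.sq_sqrt (hpos j).le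
    have hne : Real.sqrt (κ j.succ) ≠ 0 := (Real.sqrt_pos.mpr (hpos j)).ne'
    field_simp
    rw [hs]
    ring
  rw [hk 0, hk 1, hk 2]
  rw [Fin.sum_univ_three] at hnn
  linear_combination ha + (s * s') * hnn

/-- The sphere map is smooth, of any order. [folklore] -/
theorem contDiff_spherePt' {m : ℕ∞ω} : ContDiff ℝ m (spherePt κ ℓ tc c) :=
  contDiff_const.add (sphereDiff κ ℓ).contDiff

/-- The linear part `D` is injective when `ℓ ≠ 0` and the `κⱼ₊₁` are positive. [folklore] -/
theorem sphereDiff_injective (hpos : ∀ j : Fin 3, 0 < κ j.succ) (hℓ : ℓ ≠ 0) :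
    Injective (sphereDiff κ ℓ) := by
  refine (injective_iff_map_eq_zero _).2 fun u hu ↦ ?_
  ext j
  have hj := congrArg (fun z : E4 ↦ z j.succ) hu
  simp only [sphereDiff_apply_succ, PiLp.zero_apply] at hj
  have hρ : rho κ ℓ j ≠ 0 := div_ne_zero hℓ (Real.sqrt_pos.mpr (hpos j)).ne'
  simpa [hρ] using hj

/-- The sphere map is injective when `ℓ ≠ 0` and the `κⱼ₊₁` are positive. [folklore] -/
theorem spherePt_injective (hpos : ∀ j : Fin 3, 0 < κ j.succ) (hℓ : ℓ ≠ 0) :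
    Injective (spherePt κ ℓ tc c) := fun _ _ h ↦
  sphereDiff_injective hpos hℓ (add_left_cancel h)

/-! ### The round sphere as a map `S² → V` -/

section SphereMap

/-- `dim E3 = 2 + 1`, the `Fact` through which Mathlib's sphere API (`contMDiff_coe_sphere`,
`range_mfderiv_coe_sphere`, …) sees `S² ⊂ E3`. [folklore] -/
theorem factFinrankE3 : Fact (finrank ℝ E3 = 2 + 1) := ⟨by simp⟩

variable {V : Opens E4}

/-- **The round `h`-sphere of radius `ℓ` as a map `S² → V`** (with a proof that its image lies in
the chart domain). [cite: HawkingEllis1973, §9.2] -/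
def sphereMap (V : Opens E4) (κ : Fin 4 → ℝ) (ℓ tc : ℝ) (c : E3)
    (hmem : ∀ n : E3, ‖n‖ = 1 → spherePt κ ℓ tc c n ∈ (V : Set E4)) : sphere (0 : E3) 1 → V :=
  fun n ↦ ⟨spherePt κ ℓ tc c n, hmem n (norm_eq_of_mem_sphere n)⟩

variable {hmem : ∀ n : E3, ‖n‖ = 1 → spherePt κ ℓ tc c n ∈ (V : Set E4)}

/-- The value of the sphere map in `E4`. [folklore] -/
@[simp]
theorem sphereMap_coe (n : sphere (0 : E3) 1) :
    ((sphereMap V κ ℓ tc c hmem n : V) : E4) = spherePt κ ℓ tc c n := rfl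

/-- `Subtype.val ∘ sphereMap = spherePt ∘ Subtype.val`. [folklore] -/
theorem val_comp_sphereMap :
    (Subtype.val ∘ sphereMap V κ ℓ tc c hmem) = spherePt κ ℓ tc c ∘ (Subtype.val : sphere (0 : E3) 1 → E3) :=
  rfl

/-- **The round sphere is a smooth map `S² → V`** (an affine map of `E3` restricted to the
sphere; Mathlib's `contMDiff_coe_sphere`). [cite: HawkingEllis1973, §9.2] -/
theorem contMDiff_sphereMap {m : ℕ∞ω} : ContMDiff (𝓡 2) 𝓘(ℝ, E4) m (sphereMap V κ ℓ tc c hmem) := by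
  haveI := factFinrankE3
  intro n
  rw [contMDiffAt_iff_subtypeVal_comp, val_comp_sphereMap]
  exact (contDiff_spherePt'.contMDiff.comp (contMDiff_coe_sphere (n := 2))) n

/-- The inclusion of the sphere is differentiable. [folklore] -/
theorem mdifferentiableAt_coe_sphere (n : sphere (0 : E3) 1) :
    MDifferentiableAt (𝓡 2) 𝓘(ℝ, E3) (Subtype.val : sphere (0 : E3) 1 → E3) n :=
  haveI := factFinrankE3
  (contMDiff_coe_sphere (m := 1) (n := 2) n).mdifferentiableAt one_ne_zero

/-- The differential of the inclusion `S² ⊂ E3`, as an honest `E3`-valued map (this fixes the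
`E3` instances on the values, which the `TangentSpace` synonym would otherwise hide). [folklore] -/
def dS (n : sphere (0 : E3) 1) (v : TangentSpace (𝓡 2) n) : E3 :=
  mfderiv (𝓡 2) 𝓘(ℝ, E3) (Subtype.val : sphere (0 : E3) 1 → E3) n v

/-- Unfolding lemma for `dS`. [folklore] -/
theorem dS_def (n : sphere (0 : E3) 1) (v : TangentSpace (𝓡 2) n) :
    dS n v = mfderiv (𝓡 2) 𝓘(ℝ, E3) (Subtype.val : sphere (0 : E3) 1 → E3) n v := rfl

/-- `dS n` is additive. [folklore] -/
theorem dS_add (n : sphere (0 : E3) 1) (v w : TangentSpace (𝓡 2) n) : dS n (v + w) = dS n v + dS n w :=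
  map_add _ v w

/-- `dS n` is homogeneous. [folklore] -/
theorem dS_smul (n : sphere (0 : E3) 1) (a : ℝ) (v : TangentSpace (𝓡 2) n) : dS n (a • v) = a • dS n v :=
  map_smul _ a v

/-- **Tangent vectors of the sphere are orthogonal to the position vector**: `⟪n, dι_n v⟫ = 0`
(Mathlib's `range_mfderiv_coe_sphere`). [folklore] -/
theorem inner_mfderiv_coe_sphere (n : sphere (0 : E3) 1) (v : TangentSpace (𝓡 2) n) :
    ⟪(n : E3), dS n v⟫ = 0 := by
  haveI := factFinrankE3
  have h : (mfderiv (𝓡 2) 𝓘(ℝ, E3) (Subtype.val : sphere (0 : E3) 1 → E3) n v : E3) ∈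
      (ℝ ∙ (n : E3))ᗮ := by
    rw [← range_mfderiv_coe_sphere (n := 2) n]
    exact LinearMap.mem_range_self _ v
  exact Submodule.mem_orthogonal_singleton_iff_inner_right.1 h

/-- A vector orthogonal to every tangent vector of the sphere at `n` is a multiple of `n`
(Mathlib's `range_mfderiv_coe_sphere`: the tangent space is `(ℝ ∙ n)ᗮ`). [folklore] -/
theorem exists_eq_smul_of_inner_mfderiv_eq_zero (n : sphere (0 : E3) 1) {u : E3}
    (hu : ∀ v : TangentSpace (𝓡 2) n,
      ⟪u, dS n v⟫ = 0) :
    ∃ σ : ℝ, u = σ • (n : E3) := by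
  haveI := factFinrankE3
  have h1 : u ∈ ((ℝ ∙ (n : E3))ᗮ)ᗮ := by
    rw [Submodule.mem_orthogonal']
    intro w hw
    rw [← range_mfderiv_coe_sphere (n := 2) n] at hw
    obtain ⟨v, rfl⟩ := hw
    exact hu v
  rw [Submodule.orthogonal_orthogonal] at h1
  obtain ⟨σ, hσ⟩ := Submodule.mem_span_singleton.1 h1
  exact ⟨σ, hσ.symm⟩

/-- The sphere map is differentiable. [folklore] -/
theorem mdifferentiableAt_sphereMap (n : sphere (0 : E3) 1) :
    MDifferentiableAt (𝓡 2) 𝓘(ℝ, E4) (sphereMap V κ ℓ tc c hmem) n :=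
  (contMDiff_sphereMap (m := 1) n).mdifferentiableAt one_ne_zero

/-- **The differential of the round sphere**: `df_n v = D (dι_n v)`. [cite: HawkingEllis1973, §9.2] -/
theorem mfderiv_sphereMap (n : sphere (0 : E3) 1) (v : TangentSpace (𝓡 2) n) :
    mfderiv (𝓡 2) 𝓘(ℝ, E4) (sphereMap V κ ℓ tc c hmem) n v =
      sphereDiff κ ℓ (dS n v) := by
  rw [← mfderiv_subtypeVal_comp (mdifferentiableAt_sphereMap n), val_comp_sphereMap]
  have h : HasMFDerivAt (𝓡 2) 𝓘(ℝ, E4) (spherePt κ ℓ tc c ∘ (Subtype.val : sphere (0 : E3) 1 → E3)) n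
      ((sphereDiff κ ℓ).comp (mfderiv (𝓡 2) 𝓘(ℝ, E3) (Subtype.val : sphere (0 : E3) 1 → E3) n)) :=
    (hasFDerivAt_spherePt (n : E3)).hasMFDerivAt.comp n (mdifferentiableAt_coe_sphere n).hasMFDerivAt
  rw [h.mfderiv]
  rfl

/-- The differential of the round sphere is injective (for `ℓ ≠ 0`, `κⱼ₊₁ > 0`). [folklore] -/
theorem mfderiv_sphereMap_injective (hpos : ∀ j : Fin 3, 0 < κ j.succ) (hℓ : ℓ ≠ 0)
    (n : sphere (0 : E3) 1) : Injective (mfderiv (𝓡 2) 𝓘(ℝ, E4) (sphereMap V κ ℓ tc c hmem) n) := by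
  haveI := factFinrankE3
  intro v w h
  rw [mfderiv_sphereMap, mfderiv_sphereMap] at h
  exact mfderiv_coe_sphere_injective (n := 2) n (sphereDiff_injective hpos hℓ h)

/-- The round sphere is an injective map. [folklore] -/
theorem sphereMap_injective (hpos : ∀ j : Fin 3, 0 < κ j.succ) (hℓ : ℓ ≠ 0) :
    Injective (sphereMap V κ ℓ tc c hmem) := by
  intro n n' h
  have h' := congrArg (fun z : V ↦ (z : E4)) h
  simp only [sphereMap_coe] at h'
  exact Subtype.ext (spherePt_injective hpos hℓ h')

/-- **The round sphere is a smooth embedding** (`Manifold.IsSmoothEmbedding`): an injective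
immersion of the compact sphere into the Hausdorff chart domain (the tree's immersion criterion
`isSmoothEmbedding_of_injective_of_injective_mfderiv`). [cite: HawkingEllis1973, §9.2] -/
theorem isSmoothEmbedding_sphereMap (hpos : ∀ j : Fin 3, 0 < κ j.succ) (hℓ : ℓ ≠ 0) :
    Manifold.IsSmoothEmbedding (𝓡 2) 𝓘(ℝ, E4) ∞ (sphereMap V κ ℓ tc c hmem) :=
  Literature.Topology.FourManifolds.isSmoothEmbedding_of_injective_of_injective_mfderiv
    contMDiff_sphereMap (by exact_mod_cast le_top) (sphereMap_injective hpos hℓ)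
    (mfderiv_sphereMap_injective hpos hℓ)

end SphereMap

end Sphere

/-! ### Components depending on `t` alone near the slice; the metric on the sphere -/

/-- The values `κᵢ = Kᵢ(t_c)` of the component profiles on the slice. [folklore] -/
def kap (K : Fin 4 → ℝ → ℝ) (tc : ℝ) : Fin 4 → ℝ := fun i ↦ K i tc

/-- Unfolding lemma for `kap`. [folklore] -/
@[simp]
theorem kap_apply (K : Fin 4 → ℝ → ℝ) (tc : ℝ) (i : Fin 4) : kap K tc i = K i tc := rfl

/-- **Slice data for a trapped round sphere.** On an open set `W ⊆ V` the diagonal components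
depend on `t = y⁰` alone, `compᵢ(y) = Kᵢ(y⁰)`, with `Kᵢ` differentiable at `t_c` (derivative
`dKᵢ`), `K₀(t_c) < 0 < Kⱼ₊₁(t_c)`; `ℓ > 0`, and the round `h`-sphere of radius `ℓ` about
`(t_c, c)` lies in `W`. (Kasner / Bianchi-I form of the metric near the slice; Hawking–Ellis 1973,
§5.4, Wald 1984, §7.2.) [cite: HawkingEllis1973, §5.4] -/
structure SliceData (V : Opens E4) (comp : Fin 4 → E4 → ℝ) (K : Fin 4 → ℝ → ℝ) (dK : Fin 4 → ℝ)
    (W : Set E4) (ℓ tc : ℝ) (c : E3) : Prop where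
  isOpen : IsOpen W
  subset : W ⊆ (V : Set E4)
  comp_eq : ∀ y ∈ W, ∀ i, comp i y = K i (y 0)
  hasDerivAt : ∀ i, HasDerivAt (K i) (dK i) tc
  K_zero_neg : K 0 tc < 0
  K_succ_pos : ∀ j : Fin 3, 0 < K j.succ tc
  ℓ_pos : 0 < ℓ
  mem : ∀ n : E3, ‖n‖ = 1 → spherePt (kap K tc) ℓ tc c n ∈ W

namespace SliceData

variable {V : Opens E4} {comp : Fin 4 → E4 → ℝ} {K : Fin 4 → ℝ → ℝ} {dK : Fin 4 → ℝ} {W : Set E4}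
  {ℓ tc : ℝ} {c : E3}

/-- The sphere lies in the chart domain. [folklore] -/
theorem mem_V (D : SliceData V comp K dK W ℓ tc c) :
    ∀ n : E3, ‖n‖ = 1 → spherePt (kap K tc) ℓ tc c n ∈ (V : Set E4) :=
  fun n hn ↦ D.subset (D.mem n hn)

/-- The positivity hypothesis in `kap` form. [folklore] -/
theorem kap_succ_pos (D : SliceData V comp K dK W ℓ tc c) : ∀ j : Fin 3, 0 < kap K tc j.succ :=
  D.K_succ_pos

/-- **The round sphere of the slice data** as a map `S² → V`. [cite: HawkingEllis1973, §9.2] -/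
def f (D : SliceData V comp K dK W ℓ tc c) : sphere (0 : E3) 1 → V :=
  sphereMap V (kap K tc) ℓ tc c D.mem_V

/-- The components at the points of the sphere are the slice values `κᵢ`. [folklore] -/
theorem comp_spherePt (D : SliceData V comp K dK W ℓ tc c) (n : E3) (hn : ‖n‖ = 1) (i : Fin 4) :
    comp i (spherePt (kap K tc) ℓ tc c n) = kap K tc i := by
  rw [D.comp_eq _ (D.mem n hn), spherePt_apply_zero, kap_apply]

/-- **The metric at the points of the sphere is the constant diagonal form `diagForm κ`.**
[cite: HawkingEllis1973, §9.2] -/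
theorem diagMetric_spherePt (D : SliceData V comp K dK W ℓ tc c) (n : E3) (hn : ‖n‖ = 1) :
    diagMetric comp (spherePt (kap K tc) ℓ tc c n) = diagForm (kap K tc) := by
  ext X Y
  rw [diagMetric_apply, diagForm_apply]
  refine Finset.sum_congr rfl fun i _ ↦ ?_
  rw [D.comp_spherePt n hn i]

/-- **The derivative of the components at the points of the sphere**: `∂_X compᵢ = K̇ᵢ(t_c) X⁰`
(the components are `Kᵢ ∘ y⁰` on the open set `W`). [folklore] -/
theorem fderiv_comp_spherePt (D : SliceData V comp K dK W ℓ tc c) (n : E3) (hn : ‖n‖ = 1)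
    (i : Fin 4) (X : E4) : fderiv ℝ (comp i) (spherePt (kap K tc) ℓ tc c n) X = dK i * X 0 := by
  set y := spherePt (kap K tc) ℓ tc c n with hy
  have hy0 : y 0 = tc := spherePt_apply_zero n
  have hK : HasFDerivAt (fun z : E4 ↦ K i (z 0)) (dK i • (EuclideanSpace.proj 0 : E4 →L[ℝ] ℝ)) y := by
    have h1 : HasDerivAt (K i) (dK i) (y 0) := by rw [hy0]; exact D.hasDerivAt i
    exact h1.comp_hasFDerivAt y ((EuclideanSpace.proj (0 : Fin 4) : E4 →L[ℝ] ℝ).hasFDerivAt)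
  have heq : (fun z : E4 ↦ K i (z 0)) =ᶠ[𝓝 y] comp i := by
    filter_upwards [D.isOpen.mem_nhds (D.mem n hn)] with z hz
    exact (D.comp_eq z hz i).symm
  rw [(hK.congr_of_eventuallyEq heq.symm).fderiv]
  rfl

/-! ### The induced metric and the canonical null normals -/

section NullNormals

variable {hg : ∀ i, ContDiffOn ℝ ∞ (comp i) V}
  {h0 : ∀ y ∈ (V : Set E4), comp 0 y < 0} {hpos4 : ∀ i : Fin 3, ∀ y ∈ (V : Set E4), 0 < comp i.succ y}

/-- **The induced metric of the round sphere is `ℓ²` times the round metric of `S²`:**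
`g(df v, df w) = ℓ² ⟪dι v, dι w⟫`. [cite: HawkingEllis1973, §9.2] -/
theorem val_mfderiv_mfderiv (D : SliceData V comp K dK W ℓ tc c) (n : sphere (0 : E3) 1)
    (v w : TangentSpace (𝓡 2) n) :
    (diagLorentz V comp hg h0 hpos4).val (D.f n) (mfderiv (𝓡 2) 𝓘(ℝ, E4) D.f n v)
        (mfderiv (𝓡 2) 𝓘(ℝ, E4) D.f n w) =
      ℓ ^ 2 * ⟪dS n v,
        dS n w⟫ := by
  rw [SliceData.f, mfderiv_sphereMap, mfderiv_sphereMap, diagLorentz_val]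
  change diagMetric comp (spherePt (kap K tc) ℓ tc c n) _ _ = _
  rw [D.diagMetric_spherePt n (norm_eq_of_mem_sphere n), diagForm_sphereDiff D.kap_succ_pos]

/-- **The round sphere is a spacelike immersion.** [cite: HawkingEllis1973, §9.2] -/
theorem isSpacelikeImmersion (D : SliceData V comp K dK W ℓ tc c) :
    (diagLorentz V comp hg h0 hpos4).toPseudoRiemannianMetric.IsSpacelikeImmersion (𝓡 2) D.f := by
  haveI := factFinrankE3
  refine ⟨contMDiff_sphereMap, fun n v hv ↦ ?_⟩
  rw [PseudoRiemannianMetric.inducedBilin_apply]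
  change (diagLorentz V comp hg h0 hpos4).val (D.f n) _ _ > 0
  rw [val_mfderiv_mfderiv D n v v, real_inner_self_eq_norm_sq]
  have hne : dS n v ≠ 0 := by
    intro h
    apply hv
    refine mfderiv_coe_sphere_injective (n := 2) n ?_
    rw [map_zero]
    exact h
  have h1 : 0 < ‖dS n v‖ :=
    norm_pos_iff.mpr hne
  have h2 : 0 < ℓ ^ 2 := by have := D.ℓ_pos; positivity
  positivity

/-- The time component `L₀ = −(−κ₀)^{-1/2}` of the future null normals (`L± = L₀ ∂₀ ± ν̂`, with
`−(−κ₀)^{-1/2} ∂₀` the future unit normal of the slice). [cite: HawkingEllis1973, §9.2] -/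
def L0 (K : Fin 4 → ℝ → ℝ) (tc : ℝ) : ℝ := -(Real.sqrt (-K 0 tc))⁻¹

/-- The null normal vectors `L_s(n) = L₀ ∂₀ + s ν̂(n)` (`s = ±1`). [cite: HawkingEllis1973, §9.2] -/
def Lvec (K : Fin 4 → ℝ → ℝ) (tc s : ℝ) (n : E3) : E4 :=
  L0 K tc • (eb 0 : E4) + s • normalCLM (kap K tc) n

/-- The null normal fields `L_s` along the round sphere. [cite: HawkingEllis1973, §9.2] -/
def Lfield (D : SliceData V comp K dK W ℓ tc c) (s : ℝ) : NormalField 𝓘(ℝ, E4) D.f :=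
  fun n ↦ Lvec K tc s (n : E3)

/-- `κ₀ L₀² = −1`. [folklore] -/
theorem kap_zero_mul_L0_sq (D : SliceData V comp K dK W ℓ tc c) : kap K tc 0 * L0 K tc ^ 2 = -1 := by
  have hneg : 0 < -K 0 tc := by linarith [D.K_zero_neg]
  have hs : Real.sqrt (-K 0 tc) ^ 2 = -K 0 tc := Real.sq_sqrt hneg.le
  have hne : Real.sqrt (-K 0 tc) ≠ 0 := (Real.sqrt_pos.mpr hneg).ne'
  rw [kap_apply, L0]
  field_simp
  rw [hs]
  ring

/-- `L₀ < 0`. [folklore] -/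
theorem L0_neg (D : SliceData V comp K dK W ℓ tc c) : L0 K tc < 0 := by
  have hneg : 0 < -K 0 tc := by linarith [D.K_zero_neg]
  rw [L0]
  exact neg_neg_of_pos (inv_pos.mpr (Real.sqrt_pos.mpr hneg))

/-- **`L_s` is normal to the sphere.** [cite: HawkingEllis1973, §9.2] -/
theorem val_Lfield_mfderiv (D : SliceData V comp K dK W ℓ tc c) (s : ℝ) (n : sphere (0 : E3) 1)
    (v : TangentSpace (𝓡 2) n) :
    (diagLorentz V comp hg h0 hpos4).val (D.f n) (D.Lfield s n) (mfderiv (𝓡 2) 𝓘(ℝ, E4) D.f n v) = 0 := by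
  rw [SliceData.f, mfderiv_sphereMap, diagLorentz_val]
  change diagMetric comp (spherePt (kap K tc) ℓ tc c n) _ _ = 0
  rw [D.diagMetric_spherePt n (norm_eq_of_mem_sphere n), Lfield, Lvec,
    diagForm_normal_sphereDiff D.kap_succ_pos, inner_mfderiv_coe_sphere, mul_zero]

/-- **Scalar products of the null normals**: `g(L_s, L_{s'}) = −1 + s s'`. [cite: HawkingEllis1973, §9.2] -/
theorem val_Lfield_Lfield (D : SliceData V comp K dK W ℓ tc c) (s s' : ℝ) (n : sphere (0 : E3) 1) :
    (diagLorentz V comp hg h0 hpos4).val (D.f n) (D.Lfield s n) (D.Lfield s' n) = -1 + s * s' := by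
  rw [diagLorentz_val]
  change diagMetric comp (spherePt (kap K tc) ℓ tc c n) _ _ = _
  rw [D.diagMetric_spherePt n (norm_eq_of_mem_sphere n), Lfield, Lfield, Lvec, Lvec]
  exact diagForm_normal_normal D.kap_succ_pos _ _ _ _ (norm_eq_of_mem_sphere n) D.kap_zero_mul_L0_sq

/-- **`L_s` is future-directed** for the time orientation `−∂₀` (decreasing `t`):
`g(−∂₀, L_s) = −κ₀ L₀ < 0`. [cite: HawkingEllis1973, §9.2] -/
theorem val_time_Lfield (D : SliceData V comp K dK W ℓ tc c) (s : ℝ) (n : sphere (0 : E3) 1) :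
    (diagLorentz V comp hg h0 hpos4).val (D.f n) ((-1 : ℝ) • (eb 0 : E4)) (D.Lfield s n) < 0 := by
  rw [diagLorentz_val]
  change diagMetric comp (spherePt (kap K tc) ℓ tc c n) _ _ < 0
  rw [D.diagMetric_spherePt n (norm_eq_of_mem_sphere n), map_smul, FunLike.coe_smul, Pi.smul_apply,
    smul_eq_mul, diagForm_eb_left, Lfield, Lvec]
  simp only [PiLp.add_apply, PiLp.smul_apply, smul_eq_mul, normalCLM_apply_zero, mul_zero, add_zero,
    eb_apply, if_true, mul_one, kap_apply]
  have h1 := D.K_zero_neg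
  have h2 := D.L0_neg
  nlinarith [mul_pos_of_neg_of_neg h1 h2]

/-- The `E4`-valued map `n ↦ L_s(n)` is smooth on the sphere (affine in the position vector).
[folklore] -/
theorem contMDiff_Lfield (D : SliceData V comp K dK W ℓ tc c) (s : ℝ) {m : ℕ∞ω} :
    ContMDiff (𝓡 2) 𝓘(ℝ, E4) m (fun n ↦ (D.Lfield s n : E4)) := by
  haveI := factFinrankE3
  have h : ContDiff ℝ m (Lvec K tc s) := contDiff_const.add ((normalCLM (kap K tc)).contDiff.const_smul s)
  exact h.contMDiff.comp (contMDiff_coe_sphere (n := 2))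

/-- **The derivative of `n ↦ L_s(n)` along the sphere** is `s ν̂(dι v) = (s/ℓ) df v`.
[cite: HawkingEllis1973, §9.2] -/
theorem mfderiv_Lfield (D : SliceData V comp K dK W ℓ tc c) (s : ℝ) (n : sphere (0 : E3) 1)
    (v : TangentSpace (𝓡 2) n) :
    mfderiv (𝓡 2) 𝓘(ℝ, E4) (fun n ↦ (D.Lfield s n : E4)) n v =
      (s * ℓ⁻¹) • sphereDiff (kap K tc) ℓ
        (dS n v) := by
  have hL : HasFDerivAt (Lvec K tc s) (s • normalCLM (kap K tc)) (n : E3) := by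
    have := ((normalCLM (kap K tc)).hasFDerivAt (x := (n : E3))).const_smul s
    exact this.const_add _
  have h : HasMFDerivAt (𝓡 2) 𝓘(ℝ, E4) (Lvec K tc s ∘ (Subtype.val : sphere (0 : E3) 1 → E3)) n
      ((s • normalCLM (kap K tc)).comp
        (mfderiv (𝓡 2) 𝓘(ℝ, E3) (Subtype.val : sphere (0 : E3) 1 → E3) n)) :=
    hL.hasMFDerivAt.comp n (mdifferentiableAt_coe_sphere n).hasMFDerivAt
  have hfun : (fun n ↦ (D.Lfield s n : E4)) = Lvec K tc s ∘ (Subtype.val : sphere (0 : E3) 1 → E3) := rfl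
  rw [hfun, h.mfderiv]
  change s • normalCLM (kap K tc) (dS n v) =
    (s * ℓ⁻¹) • sphereDiff (kap K tc) ℓ (dS n v)
  rw [sphereDiff, FunLike.coe_smul, Pi.smul_apply, smul_smul, mul_assoc, inv_mul_cancel₀ D.ℓ_pos.ne',
    mul_one]

/-- The differential of the round sphere of the slice data: `df v = D(dι v)`. [folklore] -/
theorem mfderiv_f (D : SliceData V comp K dK W ℓ tc c) (n : sphere (0 : E3) 1)
    (v : TangentSpace (𝓡 2) n) :
    mfderiv (𝓡 2) 𝓘(ℝ, E4) D.f n v =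
      sphereDiff (kap K tc) ℓ (dS n v) := by
  rw [SliceData.f, mfderiv_sphereMap]

/-- The metric at the points of the sphere, as the constant form `diagForm κ`. [folklore] -/
theorem val_f (D : SliceData V comp K dK W ℓ tc c) (n : sphere (0 : E3) 1) :
    ((diagLorentz V comp hg h0 hpos4).val (D.f n) : E4 →L[ℝ] E4 →L[ℝ] ℝ) = diagForm (kap K tc) := by
  rw [diagLorentz_val]
  exact D.diagMetric_spherePt n (norm_eq_of_mem_sphere n)

/-- **The canonical null normal pair `(L₊, L₋)` of the round sphere** for the time orientation
`−∂₀`. [cite: HawkingEllis1973, §9.2] -/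
def nullNormalPair (D : SliceData V comp K dK W ℓ tc c) :
    LorentzianMetric.NullNormalPair (𝓡 2) (diagLorentz V comp hg h0 hpos4)
      (diagTimeOrientation (hg := hg) (h0 := h0) (hpos := hpos4) (-1) (by norm_num)) D.f where
  L := D.Lfield 1
  Lbar := D.Lfield (-1)
  isNormalTo_L := fun n v ↦ D.val_Lfield_mfderiv 1 n v
  isNormalTo_Lbar := fun n v ↦ D.val_Lfield_mfderiv (-1) n v
  isNull_L n := by
    refine ⟨by rw [D.val_Lfield_Lfield]; norm_num, fun h ↦ ?_⟩
    have := D.val_Lfield_Lfield (hg := hg) (h0 := h0) (hpos4 := hpos4) 1 (-1) n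
    rw [show D.Lfield 1 n = 0 from h, map_zero] at this
    norm_num at this
  isNull_Lbar n := by
    refine ⟨by rw [D.val_Lfield_Lfield]; norm_num, fun h ↦ ?_⟩
    have := D.val_Lfield_Lfield (hg := hg) (h0 := h0) (hpos4 := hpos4) 1 (-1) n
    rw [show D.Lfield (-1) n = 0 from h, map_zero] at this
    norm_num at this
  isFutureDirected_L n := by
    refine ⟨⟨(by rw [D.val_Lfield_Lfield]; norm_num), fun h ↦ ?_⟩, ?_⟩
    · have := D.val_Lfield_Lfield (hg := hg) (h0 := h0) (hpos4 := hpos4) 1 (-1) n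
      rw [show D.Lfield 1 n = 0 from h, map_zero] at this
      norm_num at this
    · rw [diagTimeOrientation_vectorField]
      exact D.val_time_Lfield 1 n
  isFutureDirected_Lbar n := by
    refine ⟨⟨(by rw [D.val_Lfield_Lfield]; norm_num), fun h ↦ ?_⟩, ?_⟩
    · have := D.val_Lfield_Lfield (hg := hg) (h0 := h0) (hpos4 := hpos4) 1 (-1) n
      rw [show D.Lfield (-1) n = 0 from h, map_zero] at this
      norm_num at this
    · rw [diagTimeOrientation_vectorField]
      exact D.val_time_Lfield (-1) n
  val_L_Lbar n := by rw [D.val_Lfield_Lfield]; norm_num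
  contMDiff_L n := contMDiffAt_lift_iff.2 ⟨contMDiff_sphereMap n, D.contMDiff_Lfield 1 n⟩
  contMDiff_Lbar n := contMDiffAt_lift_iff.2 ⟨contMDiff_sphereMap n, D.contMDiff_Lfield (-1) n⟩

end NullNormals

end SliceData

/-! ### The rate form and the second fundamental forms of the canonical null normals -/

/-- The logarithmic rates `rⱼ = K̇ⱼ₊₁(t_c)/Kⱼ₊₁(t_c)` of the spatial components. [cite: HawkingEllis1973, §9.2] -/
def rate (K : Fin 4 → ℝ → ℝ) (dK : Fin 4 → ℝ) (tc : ℝ) (j : Fin 3) : ℝ := dK j.succ / K j.succ tc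

/-- The rate form `R(u, u') = ∑ⱼ rⱼ uⱼ u'ⱼ` on `E3` (`= −2(−κ₀)^{1/2} K(û, û')/…`: the slice's second
fundamental form in `h`-orthonormal coordinates, up to the factor `½ L₀`). [cite: HawkingEllis1973, §9.2] -/
def Rform (K : Fin 4 → ℝ → ℝ) (dK : Fin 4 → ℝ) (tc : ℝ) (u u' : E3) : ℝ :=
  ∑ j : Fin 3, rate K dK tc j * (u j * u' j)

/-- The trace factor `m(n) = ∑ⱼ rⱼ (1 − nⱼ²)` of the null expansions. [cite: HawkingEllis1973, §9.2] -/
def mfun (K : Fin 4 → ℝ → ℝ) (dK : Fin 4 → ℝ) (tc : ℝ) (n : E3) : ℝ :=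
  ∑ j : Fin 3, rate K dK tc j * (1 - n j ^ 2)

/-- `R(cu, cu) = c² R(u, u)`. [folklore] -/
theorem Rform_smul_smul (K : Fin 4 → ℝ → ℝ) (dK : Fin 4 → ℝ) (tc a : ℝ) (u : E3) :
    Rform K dK tc (a • u) (a • u) = a ^ 2 * Rform K dK tc u u := by
  simp only [Rform, PiLp.smul_apply, smul_eq_mul, Finset.mul_sum]
  exact Finset.sum_congr rfl fun j _ ↦ by ring

/-- `R(u, u) = ∑ rⱼ uⱼ²`. [folklore] -/
theorem Rform_self (K : Fin 4 → ℝ → ℝ) (dK : Fin 4 → ℝ) (tc : ℝ) (u : E3) :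
    Rform K dK tc u u = ∑ j : Fin 3, rate K dK tc j * (u j) ^ 2 :=
  Finset.sum_congr rfl fun j _ ↦ by rw [sq]

/-- `m(n) = ∑ⱼ rⱼ − R(n, n)`. [folklore] -/
theorem mfun_eq (K : Fin 4 → ℝ → ℝ) (dK : Fin 4 → ℝ) (tc : ℝ) (n : E3) :
    mfun K dK tc n = ∑ j : Fin 3, rate K dK tc j - Rform K dK tc n n := by
  rw [mfun, Rform_self, ← Finset.sum_sub_distrib]
  exact Finset.sum_congr rfl fun j _ ↦ by ring

namespace SliceData

variable {V : Opens E4} {comp : Fin 4 → E4 → ℝ} {K : Fin 4 → ℝ → ℝ} {dK : Fin 4 → ℝ} {W : Set E4}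
  {ℓ tc : ℝ} {c : E3} {hg : ∀ i, ContDiffOn ℝ ∞ (comp i) V}
  {h0 : ∀ y ∈ (V : Set E4), comp 0 y < 0} {hpos4 : ∀ i : Fin 3, ∀ y ∈ (V : Set E4), 0 < comp i.succ y}

/-- **The Christoffel term of the null second fundamental form**: at a point of the sphere,
`g(Γ(L_s)(df v), df w) = ½ L₀ ℓ² R(dι v, dι w)` (Koszul formula for the diagonal components
`Kᵢ ∘ y⁰`: only `∂_{L_s} g(df w, df v) = L₀ ∂ₜh(df w, df v)` survives). [cite: HawkingEllis1973, §9.2] -/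
theorem val_christoffel_Lfield (D : SliceData V comp K dK W ℓ tc c) (s : ℝ) (n : sphere (0 : E3) 1)
    (v w : TangentSpace (𝓡 2) n) :
    (diagLorentz V comp hg h0 hpos4).val (D.f n)
        (christoffel (diagLorentz V comp hg h0 hpos4).toPseudoRiemannianMetric (diagMetric comp) (D.f n)
          (D.Lfield s n) (mfderiv (𝓡 2) 𝓘(ℝ, E4) D.f n v)) (mfderiv (𝓡 2) 𝓘(ℝ, E4) D.f n w) =
      2⁻¹ * L0 K tc * ℓ ^ 2 *
        Rform K dK tc (dS n v)
          (dS n w) := by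
  set dv : E3 := dS n v with hdv
  set dw : E3 := dS n w with hdw
  set x := D.f n with hx
  set X : E4 := mfderiv (𝓡 2) 𝓘(ℝ, E4) D.f n v with hX
  set Z : E4 := mfderiv (𝓡 2) 𝓘(ℝ, E4) D.f n w with hZ
  have h2 := two_mul_val_christoffel (g := (diagLorentz V comp hg h0 hpos4).toPseudoRiemannianMetric)
    (G := diagMetric comp) x (D.Lfield s n) X Z
  rw [koszulForm_eq_koszulCLM] at h2
  have hdiff : ∀ i, DifferentiableAt ℝ (comp i) (x : E4) := fun i ↦
    ((hg i).contDiffAt (V.2.mem_nhds x.2)).differentiableAt (by simp)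
  rw [koszulCLM_diagMetric hdiff] at h2
  -- the derivatives of the components at `x = f n`
  have hxpt : (x : E4) = spherePt (kap K tc) ℓ tc c n := rfl
  have hd : ∀ i (Y : E4), fderiv ℝ (comp i) (x : E4) Y = dK i * Y 0 := fun i Y ↦ by
    rw [hxpt]; exact D.fderiv_comp_spherePt n (norm_eq_of_mem_sphere n) i Y
  have hX0 : X 0 = 0 := by rw [hX, SliceData.f, mfderiv_sphereMap, sphereDiff_apply_zero]
  have hZ0 : Z 0 = 0 := by rw [hZ, SliceData.f, mfderiv_sphereMap, sphereDiff_apply_zero]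
  have hXs : ∀ j : Fin 3, X j.succ = rho (kap K tc) ℓ j * dv j := fun j ↦ by
    rw [hX, SliceData.f, mfderiv_sphereMap, sphereDiff_apply_succ]
  have hZs : ∀ j : Fin 3, Z j.succ = rho (kap K tc) ℓ j * dw j := fun j ↦ by
    rw [hZ, SliceData.f, mfderiv_sphereMap, sphereDiff_apply_succ]
  have hL0 : (show E4 from D.Lfield s n) 0 = L0 K tc := by
    simp [Lfield, Lvec]
  simp only [hd, hX0, hZ0, mul_zero, zero_mul, zero_add, sub_zero, hL0] at h2
  -- `h2 : 2 * g(Γ, Z) = ∑ᵢ dKᵢ L₀ (Zᵢ Xᵢ)`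
  have hsum : ∑ i : Fin 4, dK i * L0 K tc * (Z i * X i) = L0 K tc * ℓ ^ 2 * Rform K dK tc dv dw := by
    rw [Fin.sum_univ_four, Rform, Fin.sum_univ_three]
    simp only [show (1 : Fin 4) = (0 : Fin 3).succ from rfl, show (2 : Fin 4) = (1 : Fin 3).succ from rfl,
      show (3 : Fin 4) = (2 : Fin 3).succ from rfl, hXs, hZs, hX0, hZ0, mul_zero, zero_add]
    have hk : ∀ j : Fin 3, dK j.succ * L0 K tc *
        (rho (kap K tc) ℓ j * dw j * (rho (kap K tc) ℓ j * dv j)) =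
        L0 K tc * ℓ ^ 2 * (rate K dK tc j * (dv j * dw j)) := by
      intro j
      have hs : Real.sqrt (kap K tc j.succ) ^ 2 = kap K tc j.succ := Real.sq_sqrt (D.kap_succ_pos j).le
      have hne : Real.sqrt (kap K tc j.succ) ≠ 0 := (Real.sqrt_pos.mpr (D.kap_succ_pos j)).ne'
      have hne' : K j.succ tc ≠ 0 := (D.K_succ_pos j).ne'
      rw [rho, rate, kap_apply] at *
      field_simp
      rw [hs]
      ring
    rw [hk 0, hk 1, hk 2]
    ring
  rw [hsum] at h2
  linarith

/-- **The null second fundamental forms of the canonical null normals**: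
`χ_{L_s}(v, w) = s ℓ ⟪dι v, dι w⟫ + ½ L₀ ℓ² R(dι v, dι w)`. [cite: HawkingEllis1973, §4.2 and §9.2] -/
theorem secondFundamentalForm_Lfield (D : SliceData V comp K dK W ℓ tc c)
    [(diagLorentz V comp hg h0 hpos4).toPseudoRiemannianMetric.HasLeviCivita] (s : ℝ)
    (n : sphere (0 : E3) 1) (v w : TangentSpace (𝓡 2) n) :
    (diagLorentz V comp hg h0 hpos4).toPseudoRiemannianMetric.secondFundamentalForm (𝓡 2) D.f
        (D.Lfield s) n v w =
      s * ℓ * ⟪dS n v,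
          dS n w⟫ +
        2⁻¹ * L0 K tc * ℓ ^ 2 *
          Rform K dK tc (dS n v)
            (dS n w) := by
  haveI := factFinrankE3
  have hGd : DifferentiableAt ℝ (diagMetric comp) (D.f n : E4) :=
    differentiableAt_diagMetric fun i ↦
      ((hg i).contDiffAt (V.2.mem_nhds (D.f n).2)).differentiableAt (by simp)
  have hsf := secondFundamentalForm_eq_mfderiv (IN := 𝓡 2) (f := D.f) (ν := D.Lfield s)
    (diagLorentz_repr (hg := hg) (h0 := h0) (hpos := hpos4)) BoundarylessManifold.isInteriorPoint
    (show MDifferentiableAt (𝓡 2) 𝓘(ℝ, E4) D.f n from mdifferentiableAt_sphereMap n)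
    ((D.contMDiff_Lfield s (m := 1) n).mdifferentiableAt one_ne_zero) hGd v w
  set dv : E3 := dS n v with hdv
  set dw : E3 := dS n w with hdw
  -- the Christoffel term, read over `E4`
  have hchr : diagForm (kap K tc)
      (christoffel (diagLorentz V comp hg h0 hpos4).toPseudoRiemannianMetric (diagMetric comp) (D.f n)
        (D.Lfield s n) (sphereDiff (kap K tc) ℓ dv)) (sphereDiff (kap K tc) ℓ dw) =
      2⁻¹ * L0 K tc * ℓ ^ 2 * Rform K dK tc dv dw := by
    have h := D.val_christoffel_Lfield (hg := hg) (h0 := h0) (hpos4 := hpos4) s n v w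
    rw [D.val_f n, D.mfderiv_f n v, D.mfderiv_f n w] at h
    exact h
  rw [hsf]
  dsimp only
  rw [D.val_f n, D.mfderiv_f n v, D.mfderiv_f n w, D.mfderiv_Lfield s n v]
  show diagForm (kap K tc) ((s * ℓ⁻¹) • sphereDiff (kap K tc) ℓ dv +
      christoffel (diagLorentz V comp hg h0 hpos4).toPseudoRiemannianMetric (diagMetric comp) (D.f n)
        (D.Lfield s n) (sphereDiff (kap K tc) ℓ dv)) (sphereDiff (kap K tc) ℓ dw) = _
  rw [map_add, _root_.add_apply, map_smul, FunLike.coe_smul, Pi.smul_apply, smul_eq_mul,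
    diagForm_sphereDiff D.kap_succ_pos, hchr]
  have hℓ : ℓ ≠ 0 := D.ℓ_pos.ne'
  field_simp

/-! ### The null expansions of the canonical null normals -/

/-- **The null expansions of the canonical null normals of the round sphere**:
`θ_{L_s} = 2s/ℓ + ½ L₀ m(n)`, `m(n) = ∑ⱼ rⱼ(1 − nⱼ²)` — the metric trace of `χ_{L_s}` in an
orthogonal frame of the induced metric `ℓ² ⟪dι·, dι·⟫`, the frame vectors completing with `n`
to an orthonormal triple of `E3`. [cite: HawkingEllis1973, §9.2] -/
theorem nullExpansion_Lfield (D : SliceData V comp K dK W ℓ tc c)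
    [(diagLorentz V comp hg h0 hpos4).toPseudoRiemannianMetric.HasLeviCivita]
    (hpb : PseudoRiemannianMetric.contMDiff_pullbackBilin 𝓘(ℝ, E4) V (𝓡 2) (sphere (0 : E3) 1) ∞)
    (hf : (diagLorentz V comp hg h0 hpos4).toPseudoRiemannianMetric.IsSpacelikeImmersion (𝓡 2) D.f)
    (s : ℝ) (n : sphere (0 : E3) 1) :
    (diagLorentz V comp hg h0 hpos4).nullExpansion D.f hpb hf (D.Lfield s) n =
      2 * s / ℓ + 2⁻¹ * L0 K tc * mfun K dK tc n := by
  haveI := factFinrankE3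
  classical
  set g' := (diagLorentz V comp hg h0 hpos4).toPseudoRiemannianMetric.inducedMetric D.f hpb hf with hg'
  -- an orthogonal frame of the induced metric; the index type has two elements
  obtain ⟨e, he, hc⟩ := g'.exists_isOrthoᵢ_basis n
  have hfin : finrank ℝ (TangentSpace (𝓡 2) n) = 2 := finrank_euclideanSpace_fin
  have hcard : Fintype.card (Fin (finrank ℝ (TangentSpace (𝓡 2) n))) = 2 :=
    (Fintype.card_fin _).trans hfin
  rw [LorentzianMetric.nullExpansion, LorentzianMetric.nullSecondFundamentalForm_eq,
    trace_eq_sum_div g' n e he hc]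
  -- notation for the tangent images
  set u : Fin (finrank ℝ (TangentSpace (𝓡 2) n)) → E3 := fun i ↦
    dS n (e i) with hu
  have hval : ∀ i j, g'.val n (e i) (e j) = ℓ ^ 2 * ⟪u i, u j⟫ := fun i j ↦ by
    rw [hg', PseudoRiemannianMetric.inducedMetric_val, PseudoRiemannianMetric.inducedBilin_apply]
    exact D.val_mfderiv_mfderiv n (e i) (e j)
  have hune : ∀ i, u i ≠ 0 := by
    intro i h
    apply hc i
    rw [hval, h, inner_zero_left, mul_zero]
  have hunorm : ∀ i, 0 < ‖u i‖ := fun i ↦ norm_pos_iff.mpr (hune i)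
  have hℓ : ℓ ≠ 0 := D.ℓ_pos.ne'
  -- each term of the frame sum
  have hterm : ∀ i, (diagLorentz V comp hg h0 hpos4).toPseudoRiemannianMetric.secondFundamentalForm
      (𝓡 2) D.f (D.Lfield s) n (e i) (e i) / g'.val n (e i) (e i) =
      s / ℓ + 2⁻¹ * L0 K tc * Rform K dK tc (‖u i‖⁻¹ • u i) (‖u i‖⁻¹ • u i) := by
    intro i
    rw [D.secondFundamentalForm_Lfield s n,
      show dS n (e i) = u i from rfl,
      hval, Rform_smul_smul, real_inner_self_eq_norm_sq]
    have hn0 : ‖u i‖ ≠ 0 := (hunorm i).ne'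
    field_simp
  simp_rw [hterm]
  rw [Finset.sum_add_distrib, Finset.sum_const, Finset.card_univ, ← Finset.mul_sum, nsmul_eq_mul,
    hcard]
  -- the orthonormal triple `(û₀, û₁, n)`
  obtain ⟨σ, -⟩ : ∃ σ : Fin 2 ≃ Fin (finrank ℝ (TangentSpace (𝓡 2) n)), True :=
    ⟨(Fintype.equivFinOfCardEq hcard).symm, trivial⟩
  set û : Fin (finrank ℝ (TangentSpace (𝓡 2) n)) → E3 := fun i ↦ ‖u i‖⁻¹ • u i with hû
  have hû_norm : ∀ i, ‖û i‖ = 1 := fun i ↦ by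
    rw [hû]
    dsimp only
    rw [norm_smul, norm_inv, norm_norm, inv_mul_cancel₀ (hunorm i).ne']
  have hû_unit : ∀ i, ⟪û i, û i⟫ = 1 := fun i ↦ by
    rw [real_inner_self_eq_norm_sq, hû_norm, one_pow]
  have hû_orth : ∀ i j, i ≠ j → ⟪û i, û j⟫ = 0 := fun i j hij ↦ by
    have h1 : g'.toBilinForm n (e i) (e j) = 0 := he hij
    rw [PseudoRiemannianMetric.toBilinForm_apply, hval] at h1
    have h2 : ⟪u i, u j⟫ = 0 := by
      have : ℓ ^ 2 ≠ 0 := pow_ne_zero 2 hℓ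
      exact (mul_eq_zero.mp h1).resolve_left this
    rw [hû]
    dsimp only
    rw [real_inner_smul_left, real_inner_smul_right, h2, mul_zero, mul_zero]
  have hû_n' : ∀ i, ⟪(n : E3), û i⟫ = 0 := fun i ↦ by
    rw [hû]
    dsimp only
    rw [real_inner_smul_right, inner_mfderiv_coe_sphere, mul_zero]
  have hû_n : ∀ i, ⟪û i, (n : E3)⟫ = 0 := fun i ↦ by rw [real_inner_comm, hû_n']
  have hnn : ⟪(n : E3), (n : E3)⟫ = 1 := by
    rw [real_inner_self_eq_norm_sq, norm_eq_of_mem_sphere, one_pow]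
  set wv : Fin 3 → E3 := ![û (σ 0), û (σ 1), (n : E3)] with hwv
  have hσ : σ 0 ≠ σ 1 := fun h ↦ by simpa using σ.injective h
  have hon : ∀ a b : Fin 3, ⟪wv a, wv b⟫ = if a = b then (1 : ℝ) else 0 := by
    intro a b
    fin_cases a <;> fin_cases b <;>
      simp [wv, hû_norm, hû_orth _ _ hσ, hû_orth _ _ hσ.symm, hû_n, hû_n', norm_eq_of_mem_sphere n]
  have hsum := sum_weighted_sq_eq_of_orthonormal wv hon (rate K dK tc)
  rw [Fin.sum_univ_three] at hsum
  simp only [wv, Matrix.cons_val_zero, Matrix.cons_val_one, Matrix.cons_val] at hsum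
  -- `∑_{i : ι} R(ûᵢ, ûᵢ) = R(û(σ0)) + R(û(σ1))`
  have hRsum : ∑ i : Fin (finrank ℝ (TangentSpace (𝓡 2) n)), Rform K dK tc (û i) (û i) =
      Rform K dK tc (û (σ 0)) (û (σ 0)) + Rform K dK tc (û (σ 1)) (û (σ 1)) := by
    rw [← Equiv.sum_comp σ, Fin.sum_univ_two]
  have hR : ∑ i : Fin (finrank ℝ (TangentSpace (𝓡 2) n)), Rform K dK tc (û i) (û i) = mfun K dK tc n := by
    rw [hRsum, mfun_eq, Rform_self, Rform_self, Rform_self]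
    linarith
  rw [show (∑ i : Fin (finrank ℝ (TangentSpace (𝓡 2) n)), Rform K dK tc (‖u i‖⁻¹ • u i) (‖u i‖⁻¹ • u i)) =
      ∑ i : Fin (finrank ℝ (TangentSpace (𝓡 2) n)), Rform K dK tc (û i) (û i) from rfl, hR]
  push_cast
  ring

/-- **Both null expansions of the canonical pair are negative** under the quantitative trapping
condition `4 √(−κ₀) < ℓ m(n)`: `θ₊ = 2/ℓ + ½L₀ m < 0 ⇔ 4(−κ₀)^{1/2} < ℓ m`, and
`θ₋ = −2/ℓ + ½ L₀ m < 0` since `L₀ < 0 < m`. [cite: HawkingEllis1973, §9.2] -/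
theorem nullExpansion_Lfield_neg (D : SliceData V comp K dK W ℓ tc c)
    [(diagLorentz V comp hg h0 hpos4).toPseudoRiemannianMetric.HasLeviCivita]
    (hpb : PseudoRiemannianMetric.contMDiff_pullbackBilin 𝓘(ℝ, E4) V (𝓡 2) (sphere (0 : E3) 1) ∞)
    (hf : (diagLorentz V comp hg h0 hpos4).toPseudoRiemannianMetric.IsSpacelikeImmersion (𝓡 2) D.f)
    (n : sphere (0 : E3) 1) (htrap : 4 * Real.sqrt (-K 0 tc) < ℓ * mfun K dK tc n) {s : ℝ}
    (hs : s = 1 ∨ s = -1) :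
    (diagLorentz V comp hg h0 hpos4).nullExpansion D.f hpb hf (D.Lfield s) n < 0 := by
  rw [D.nullExpansion_Lfield hpb hf s n]
  have hℓ := D.ℓ_pos
  have hneg : 0 < -K 0 tc := by linarith [D.K_zero_neg]
  set q := Real.sqrt (-K 0 tc) with hq
  have hq0 : 0 < q := Real.sqrt_pos.mpr hneg
  have hL : L0 K tc = -q⁻¹ := rfl
  have hm : 0 < mfun K dK tc n := by
    by_contra h
    have h' : mfun K dK tc n ≤ 0 := not_lt.mp h
    have : ℓ * mfun K dK tc n ≤ 0 := mul_nonpos_of_nonneg_of_nonpos hℓ.le h'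
    linarith [mul_pos (by norm_num : (0 : ℝ) < 4) hq0]
  rw [hL]
  rcases hs with rfl | rfl
  · -- `θ₊`
    have key : 2 * (1 : ℝ) / ℓ + 2⁻¹ * -q⁻¹ * mfun K dK tc n =
        (4 * q - ℓ * mfun K dK tc n) / (2 * ℓ * q) := by
      field_simp
      ring
    rw [key]
    exact div_neg_of_neg_of_pos (by linarith) (by positivity)
  · have h1 : 2 * (-1 : ℝ) / ℓ < 0 := by
      rw [mul_neg_one]; exact div_neg_of_neg_of_pos (by norm_num) hℓ
    have h2 : 2⁻¹ * -q⁻¹ * mfun K dK tc n < 0 := by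
      have : 0 < 2⁻¹ * q⁻¹ * mfun K dK tc n := by positivity
      linarith
    linarith

end SliceData

/-! ### Classification of the null normals of the round sphere -/

section Classification

variable {κ : Fin 4 → ℝ} {ℓ : ℝ}

/-- The `h`-dual spatial part `u(X) = (√κⱼ₊₁ Xⱼ₊₁)ⱼ ∈ E3` of a vector `X ∈ E4`. [folklore] -/
def spatialDual (κ : Fin 4 → ℝ) (X : E4) : E3 :=
  WithLp.toLp 2 fun j : Fin 3 ↦ Real.sqrt (κ j.succ) * X j.succ

/-- Components of `spatialDual`. [folklore] -/
@[simp]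
theorem spatialDual_apply (κ : Fin 4 → ℝ) (X : E4) (j : Fin 3) :
    spatialDual κ X j = Real.sqrt (κ j.succ) * X j.succ := rfl

/-- `G(X, D w) = ℓ ⟪u(X), w⟫`. [folklore] -/
theorem diagForm_sphereDiff_right (hpos : ∀ j : Fin 3, 0 < κ j.succ) (X : E4) (w : E3) :
    diagForm κ X (sphereDiff κ ℓ w) = ℓ * ⟪spatialDual κ X, w⟫ := by
  rw [diagForm_apply, Fin.sum_univ_four, inner_eq_sum, Fin.sum_univ_three]
  simp only [sphereDiff_apply_zero, mul_zero,
    show (1 : Fin 4) = (0 : Fin 3).succ from rfl, show (2 : Fin 4) = (1 : Fin 3).succ from rfl,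
    show (3 : Fin 4) = (2 : Fin 3).succ from rfl, sphereDiff_apply_succ, spatialDual_apply]
  have hk : ∀ j : Fin 3, κ j.succ * (X j.succ * (rho κ ℓ j * w j)) =
      ℓ * (Real.sqrt (κ j.succ) * X j.succ * w j) := by
    intro j
    have hs : Real.sqrt (κ j.succ) ^ 2 = κ j.succ := Real.sq_sqrt (hpos j).le
    have hne : Real.sqrt (κ j.succ) ≠ 0 := (Real.sqrt_pos.mpr (hpos j)).ne'
    rw [rho]
    field_simp
    rw [hs]
    ring
  rw [zero_add, hk 0, hk 1, hk 2]
  ring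

/-- A vector whose `h`-dual spatial part is `σ n` is `X⁰ ∂₀ + σ ν̂(n)`. [folklore] -/
theorem eq_smul_eb_add_of_spatialDual (hpos : ∀ j : Fin 3, 0 < κ j.succ) (X : E4) (σ : ℝ) (n : E3)
    (h : spatialDual κ X = σ • n) : X = X 0 • (eb 0 : E4) + σ • normalCLM κ n := by
  ext i
  refine Fin.cases ?_ (fun j ↦ ?_) i
  · simp
  · have hj := congrArg (fun z : E3 ↦ z j) h
    simp only [spatialDual_apply, PiLp.smul_apply, smul_eq_mul] at hj
    have hne : Real.sqrt (κ j.succ) ≠ 0 := (Real.sqrt_pos.mpr (hpos j)).ne'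
    simp only [PiLp.add_apply, PiLp.smul_apply, smul_eq_mul, eb_apply, Fin.succ_ne_zero, if_false,
      mul_zero, zero_add, normalCLM_apply_succ]
    field_simp
    linear_combination hj

/-- `G(a∂₀ + sν̂, a∂₀ + s'ν̂) = κ₀ a² + s s'` for `|n| = 1`. [folklore] -/
theorem diagForm_normal_normal' (hpos : ∀ j : Fin 3, 0 < κ j.succ) (a s s' : ℝ) (n : E3)
    (hn : ‖n‖ = 1) :
    diagForm κ (a • (eb 0 : E4) + s • normalCLM κ n) (a • (eb 0 : E4) + s' • normalCLM κ n) =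
      κ 0 * a ^ 2 + s * s' := by
  have hnn : ∑ j : Fin 3, n j * n j = 1 := by
    rw [← inner_eq_sum, real_inner_self_eq_norm_sq, hn, one_pow]
  rw [diagForm_apply, Fin.sum_univ_four]
  simp only [show (1 : Fin 4) = (0 : Fin 3).succ from rfl, show (2 : Fin 4) = (1 : Fin 3).succ from rfl,
    show (3 : Fin 4) = (2 : Fin 3).succ from rfl, PiLp.add_apply, PiLp.smul_apply, smul_eq_mul,
    normalCLM_apply_succ, normalCLM_apply_zero, eb_apply, Fin.succ_ne_zero, if_false, if_true,
    mul_zero, add_zero, mul_one]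
  have hk : ∀ j : Fin 3, κ j.succ * ((0 + s * ((Real.sqrt (κ j.succ))⁻¹ * n j)) *
      (0 + s' * ((Real.sqrt (κ j.succ))⁻¹ * n j))) = s * s' * (n j * n j) := by
    intro j
    have hs : Real.sqrt (κ j.succ) ^ 2 = κ j.succ := Real.sq_sqrt (hpos j).le
    have hne : Real.sqrt (κ j.succ) ≠ 0 := (Real.sqrt_pos.mpr (hpos j)).ne'
    field_simp
    rw [hs]
    ring
  rw [hk 0, hk 1, hk 2]
  rw [Fin.sum_univ_three] at hnn
  linear_combination (s * s') * hnn

end Classification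

namespace SliceData

variable {V : Opens E4} {comp : Fin 4 → E4 → ℝ} {K : Fin 4 → ℝ → ℝ} {dK : Fin 4 → ℝ} {W : Set E4}
  {ℓ tc : ℝ} {c : E3} {hg : ∀ i, ContDiffOn ℝ ∞ (comp i) V}
  {h0 : ∀ y ∈ (V : Set E4), comp 0 y < 0} {hpos4 : ∀ i : Fin 3, ∀ y ∈ (V : Set E4), 0 < comp i.succ y}

/-- **Classification of the future null normals of the round sphere.** A vector `X` at `f(n)`
which is `G`-orthogonal to the sphere, null, and future-directed for `−∂₀` is a positive
multiple of `L₊(n)` or of `L₋(n)`: `X = a L_s(n)`, `a > 0`, `s = ±1` (the normal plane is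
spanned by `∂₀, ν̂`; O'Neill 1983, Ch. 5, Lemma 5.26 ff.). [cite: ONeill1983, Ch. 5, Lemma 5.26] -/
theorem exists_eq_smul_Lvec (D : SliceData V comp K dK W ℓ tc c) (n : sphere (0 : E3) 1) (X : E4)
    (hnormal : ∀ v : TangentSpace (𝓡 2) n, diagForm (kap K tc) X (sphereDiff (kap K tc) ℓ (dS n v)) = 0)
    (hnull : diagForm (kap K tc) X X = 0)
    (hfut : diagForm (kap K tc) ((-1 : ℝ) • (eb 0 : E4)) X < 0) :
    ∃ s : ℝ, (s = 1 ∨ s = -1) ∧ ∃ a : ℝ, 0 < a ∧ X = a • Lvec K tc s n := by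
  have hℓ : ℓ ≠ 0 := D.ℓ_pos.ne'
  -- the spatial dual is orthogonal to the sphere, hence radial
  have hu : ∀ v : TangentSpace (𝓡 2) n, ⟪spatialDual (kap K tc) X, dS n v⟫ = 0 := fun v ↦ by
    have h := hnormal v
    rw [diagForm_sphereDiff_right D.kap_succ_pos] at h
    exact (mul_eq_zero.mp h).resolve_left hℓ
  obtain ⟨σ, hσ⟩ := exists_eq_smul_of_inner_mfderiv_eq_zero n hu
  have hX := eq_smul_eb_add_of_spatialDual D.kap_succ_pos X σ n hσ
  -- null: `κ₀ X₀² + σ² = 0`; future: `X₀ < 0`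
  rw [hX, diagForm_normal_normal' D.kap_succ_pos _ _ _ _ (norm_eq_of_mem_sphere n)] at hnull
  rw [hX, map_smul, FunLike.coe_smul, Pi.smul_apply, smul_eq_mul, diagForm_eb_left] at hfut
  simp only [PiLp.add_apply, PiLp.smul_apply, smul_eq_mul, eb_apply, if_true, mul_one,
    normalCLM_apply_zero, mul_zero, add_zero, kap_apply] at hfut
  have hK0 := D.K_zero_neg
  have hX0 : X 0 < 0 := by nlinarith
  have hneg : 0 < -K 0 tc := by linarith
  set q := Real.sqrt (-K 0 tc) with hq
  have hq0 : 0 < q := Real.sqrt_pos.mpr hneg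
  have hqq : q ^ 2 = -K 0 tc := Real.sq_sqrt hneg.le
  set a := -X 0 * q with ha
  have ha0 : 0 < a := mul_pos (by linarith) hq0
  have hσa : σ ^ 2 = a ^ 2 := by
    rw [kap_apply] at hnull
    rw [ha, mul_pow, hqq]
    nlinarith
  have hL0a : a * L0 K tc = X 0 := by
    rw [ha, L0, ← hq]
    field_simp
  rcases sq_eq_sq_iff_eq_or_eq_neg.mp hσa with hcase | hcase
  · refine ⟨1, Or.inl rfl, a, ha0, ?_⟩
    rw [hX, Lvec, smul_add, smul_smul, smul_smul, hL0a, mul_one, hcase]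
  · refine ⟨-1, Or.inr rfl, a, ha0, ?_⟩
    rw [hX, Lvec, smul_add, smul_smul, smul_smul, hL0a, mul_neg_one, hcase]

/-- The data of a null normal pair, read over `E4` at a point of the sphere. [folklore] -/
theorem nullNormal_conditions (D : SliceData V comp K dK W ℓ tc c)
    (P : LorentzianMetric.NullNormalPair (𝓡 2) (diagLorentz V comp hg h0 hpos4)
      (diagTimeOrientation (hg := hg) (h0 := h0) (hpos := hpos4) (-1) (by norm_num)) D.f)
    (n : sphere (0 : E3) 1) :
    ((∀ v : TangentSpace (𝓡 2) n, diagForm (kap K tc) (P.L n) (sphereDiff (kap K tc) ℓ (dS n v)) = 0) ∧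
      diagForm (kap K tc) (P.L n) (P.L n) = 0 ∧
      diagForm (kap K tc) ((-1 : ℝ) • (eb 0 : E4)) (P.L n) < 0) ∧
    ((∀ v : TangentSpace (𝓡 2) n, diagForm (kap K tc) (P.Lbar n) (sphereDiff (kap K tc) ℓ (dS n v)) = 0) ∧
      diagForm (kap K tc) (P.Lbar n) (P.Lbar n) = 0 ∧
      diagForm (kap K tc) ((-1 : ℝ) • (eb 0 : E4)) (P.Lbar n) < 0) := by
  refine ⟨⟨fun v ↦ ?_, ?_, ?_⟩, ⟨fun v ↦ ?_, ?_, ?_⟩⟩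
  · have h := P.isNormalTo_L n v
    rw [D.val_f n, D.mfderiv_f n v] at h
    exact h
  · have h := (P.isNull_L n).1
    rw [D.val_f n] at h
    exact h
  · have h := (P.isFutureDirected_L n).2
    rw [diagTimeOrientation_vectorField, D.val_f n] at h
    exact h
  · have h := P.isNormalTo_Lbar n v
    rw [D.val_f n, D.mfderiv_f n v] at h
    exact h
  · have h := (P.isNull_Lbar n).1
    rw [D.val_f n] at h
    exact h
  · have h := (P.isFutureDirected_Lbar n).2
    rw [diagTimeOrientation_vectorField, D.val_f n] at h
    exact h

/-- **Every null normal pair of the round sphere is `(a L_s, a⁻¹ L_{−s})` pointwise**, `a > 0`,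
`s = ±1` (from the classification of future null normals and `g(L, L̲) = −2`).
[cite: ONeill1983, Ch. 5, Lemma 5.26] -/
theorem pair_pointwise (D : SliceData V comp K dK W ℓ tc c)
    (P : LorentzianMetric.NullNormalPair (𝓡 2) (diagLorentz V comp hg h0 hpos4)
      (diagTimeOrientation (hg := hg) (h0 := h0) (hpos := hpos4) (-1) (by norm_num)) D.f)
    (n : sphere (0 : E3) 1) :
    ∃ s : ℝ, (s = 1 ∨ s = -1) ∧ ∃ a : ℝ, 0 < a ∧ (P.L n : E4) = a • Lvec K tc s n ∧
      (P.Lbar n : E4) = a⁻¹ • Lvec K tc (-s) n := by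
  obtain ⟨⟨h1, h2, h3⟩, ⟨h4, h5, h6⟩⟩ := D.nullNormal_conditions P n
  obtain ⟨s, hs, a, ha, hL⟩ := D.exists_eq_smul_Lvec n (P.L n) h1 h2 h3
  obtain ⟨s', hs', b, hb, hLbar⟩ := D.exists_eq_smul_Lvec n (P.Lbar n) h4 h5 h6
  have hpair := P.val_L_Lbar n
  rw [D.val_f n] at hpair
  have hpair' : diagForm (kap K tc) (a • Lvec K tc s n) (b • Lvec K tc s' n) = -2 := by
    rw [← hL, ← hLbar]; exact hpair
  simp only [map_smul, FunLike.coe_smul, Pi.smul_apply, smul_eq_mul] at hpair'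
  rw [Lvec, Lvec, diagForm_normal_normal D.kap_succ_pos _ _ _ _ (norm_eq_of_mem_sphere n)
    D.kap_zero_mul_L0_sq] at hpair'
  -- `a b (−1 + s s') = −2` with `a, b > 0`, `s, s' = ±1` forces `s' = −s`, `a b = 1`
  have hss : s' = -s := by
    rcases hs with rfl | rfl <;> rcases hs' with rfl | rfl
    · norm_num at hpair'
    · norm_num
    · norm_num
    · norm_num at hpair'
  subst hss
  have hab : a * b = 1 := by
    rcases hs with rfl | rfl <;> norm_num at hpair' <;> nlinarith
  refine ⟨s, hs, a, ha, hL, ?_⟩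
  rw [hLbar, show b = a⁻¹ from (eq_inv_of_mul_eq_one_right hab)]

end SliceData

/-! ### Rescaled null normals: `χ_{aL} = a χ_L`, and the main theorem -/

namespace SliceData

variable {V : Opens E4} {comp : Fin 4 → E4 → ℝ} {K : Fin 4 → ℝ → ℝ} {dK : Fin 4 → ℝ} {W : Set E4}
  {ℓ tc : ℝ} {c : E3} {hg : ∀ i, ContDiffOn ℝ ∞ (comp i) V}
  {h0 : ∀ y ∈ (V : Set E4), comp 0 y < 0} {hpos4 : ∀ i : Fin 3, ∀ y ∈ (V : Set E4), 0 < comp i.succ y}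

/-- `y ↦ G(F y, H y)` is differentiable along the sphere when `F, H : S² → E4` are (the constant
form `diagForm κ` is a bounded bilinear map). [folklore] -/
theorem mdifferentiableAt_diagForm_apply {F H : sphere (0 : E3) 1 → E4} {n : sphere (0 : E3) 1}
    (hF : MDifferentiableAt (𝓡 2) 𝓘(ℝ, E4) F n) (hH : MDifferentiableAt (𝓡 2) 𝓘(ℝ, E4) H n) :
    MDifferentiableAt (𝓡 2) 𝓘(ℝ, ℝ) (fun y ↦ diagForm (kap K tc) (F y) (H y)) n := by
  have hb : ContDiff ℝ 1 (fun p : E4 × E4 ↦ diagForm (kap K tc) p.1 p.2) :=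
    ((diagForm (kap K tc)).isBoundedBilinearMap).contDiff
  have h := (hb.contMDiff.mdifferentiableAt one_ne_zero).comp n (hF.prodMk_space hH)
  exact h

/-- The `E4`-valued null normal of a pair is differentiable along the sphere. [folklore] -/
theorem mdifferentiableAt_pair_L (D : SliceData V comp K dK W ℓ tc c)
    (P : LorentzianMetric.NullNormalPair (𝓡 2) (diagLorentz V comp hg h0 hpos4)
      (diagTimeOrientation (hg := hg) (h0 := h0) (hpos := hpos4) (-1) (by norm_num)) D.f)
    (n : sphere (0 : E3) 1) : MDifferentiableAt (𝓡 2) 𝓘(ℝ, E4) (fun y ↦ (P.L y : E4)) n :=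
  ((contMDiffAt_lift_iff.1 (P.contMDiff_L n)).2).mdifferentiableAt one_ne_zero

/-- The `E4`-valued second null normal of a pair is differentiable along the sphere. [folklore] -/
theorem mdifferentiableAt_pair_Lbar (D : SliceData V comp K dK W ℓ tc c)
    (P : LorentzianMetric.NullNormalPair (𝓡 2) (diagLorentz V comp hg h0 hpos4)
      (diagTimeOrientation (hg := hg) (h0 := h0) (hpos := hpos4) (-1) (by norm_num)) D.f)
    (n : sphere (0 : E3) 1) : MDifferentiableAt (𝓡 2) 𝓘(ℝ, E4) (fun y ↦ (P.Lbar y : E4)) n :=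
  ((contMDiffAt_lift_iff.1 (P.contMDiff_Lbar n)).2).mdifferentiableAt one_ne_zero

/-- **Rescaling a null normal rescales its null second fundamental form**: if a normal field `ν`
agrees near `n` with `A · L_s` for a function `A` differentiable at `n`, then
`χ_ν(v, w) = A(n) χ_{L_s}(v, w)` at `n` (the term `dA(v) G(L_s, df w)` vanishes by normality;
O'Neill 1983, Ch. 4, Lemma 4.18 ff.). [cite: ONeill1983, Ch. 4, Lemma 4.18] -/
theorem secondFundamentalForm_of_eventuallyEq_smul (D : SliceData V comp K dK W ℓ tc c)
    [(diagLorentz V comp hg h0 hpos4).toPseudoRiemannianMetric.HasLeviCivita] (s : ℝ)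
    (ν : NormalField 𝓘(ℝ, E4) D.f) (A : sphere (0 : E3) 1 → ℝ) (n : sphere (0 : E3) 1)
    (hν : MDifferentiableAt (𝓡 2) 𝓘(ℝ, E4) (fun y ↦ (ν y : E4)) n)
    (hA : MDifferentiableAt (𝓡 2) 𝓘(ℝ, ℝ) A n)
    (heq : (fun y ↦ (ν y : E4)) =ᶠ[𝓝 n] fun y ↦ A y • (D.Lfield s y : E4))
    (v w : TangentSpace (𝓡 2) n) :
    (diagLorentz V comp hg h0 hpos4).toPseudoRiemannianMetric.secondFundamentalForm (𝓡 2) D.f ν n v w =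
      A n * (diagLorentz V comp hg h0 hpos4).toPseudoRiemannianMetric.secondFundamentalForm (𝓡 2) D.f
        (D.Lfield s) n v w := by
  haveI := factFinrankE3
  have hGd : DifferentiableAt ℝ (diagMetric comp) (D.f n : E4) :=
    differentiableAt_diagMetric fun i ↦
      ((hg i).contDiffAt (V.2.mem_nhds (D.f n).2)).differentiableAt (by simp)
  have hL : MDifferentiableAt (𝓡 2) 𝓘(ℝ, E4) (fun y ↦ (D.Lfield s y : E4)) n :=
    (D.contMDiff_Lfield s (m := 1) n).mdifferentiableAt one_ne_zero
  have hsfν := secondFundamentalForm_eq_mfderiv (IN := 𝓡 2) (f := D.f) (ν := ν)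
    (diagLorentz_repr (hg := hg) (h0 := h0) (hpos := hpos4)) BoundarylessManifold.isInteriorPoint
    (show MDifferentiableAt (𝓡 2) 𝓘(ℝ, E4) D.f n from mdifferentiableAt_sphereMap n) hν hGd v w
  have hsfL := secondFundamentalForm_eq_mfderiv (IN := 𝓡 2) (f := D.f) (ν := D.Lfield s)
    (diagLorentz_repr (hg := hg) (h0 := h0) (hpos := hpos4)) BoundarylessManifold.isInteriorPoint
    (show MDifferentiableAt (𝓡 2) 𝓘(ℝ, E4) D.f n from mdifferentiableAt_sphereMap n) hL hGd v w
  -- the derivative of `ν = A • L` at `n` (product rule, `mvfderiv_smul`)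
  set dLv : E4 := mfderiv (𝓡 2) 𝓘(ℝ, E4) (fun y ↦ (D.Lfield s y : E4)) n v with hdLv
  set dA : ℝ := mfderiv (𝓡 2) 𝓘(ℝ, ℝ) A n v with hdA
  set Ln : E4 := D.Lfield s n with hLn
  have hprod : (mfderiv (𝓡 2) 𝓘(ℝ, E4) (fun y ↦ (ν y : E4)) n v : E4) = A n • dLv + dA • Ln := by
    rw [heq.mfderiv_eq]
    have h := congrArg (fun T ↦ T v)
      (mvfderiv_smul (I := 𝓡 2) (x := n) hA (g := fun y ↦ (D.Lfield s y : E4)) hL)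
    exact h
  have hνn : (ν n : E4) = A n • (D.Lfield s n : E4) := heq.eq_of_nhds
  -- read everything over `E4`
  set dv : E3 := dS n v with hdv
  set dw : E3 := dS n w with hdw
  have hnormal : diagForm (kap K tc) (D.Lfield s n) (sphereDiff (kap K tc) ℓ dw) = 0 := by
    have h := D.val_Lfield_mfderiv (hg := hg) (h0 := h0) (hpos4 := hpos4) s n w
    rw [D.val_f n, D.mfderiv_f n w] at h
    exact h
  rw [hsfν, hsfL]
  dsimp only
  rw [D.val_f n, D.mfderiv_f n v, D.mfderiv_f n w, hprod, hνn]
  show diagForm (kap K tc) (A n • dLv + dA • Ln +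
      christoffel (diagLorentz V comp hg h0 hpos4).toPseudoRiemannianMetric (diagMetric comp) (D.f n)
        (A n • Ln) (sphereDiff (kap K tc) ℓ dv)) (sphereDiff (kap K tc) ℓ dw) =
    A n * diagForm (kap K tc) (dLv +
      christoffel (diagLorentz V comp hg h0 hpos4).toPseudoRiemannianMetric (diagMetric comp) (D.f n)
        Ln (sphereDiff (kap K tc) ℓ dv)) (sphereDiff (kap K tc) ℓ dw)
  rw [christoffel_smul]
  have hnormal' : diagForm (kap K tc) Ln (sphereDiff (kap K tc) ℓ dw) = 0 := hnormal
  simp only [map_add, map_smul, _root_.add_apply, FunLike.coe_smul, Pi.smul_apply, smul_eq_mul, hnormal',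
    mul_zero, add_zero]
  ring

/-- The metric trace is homogeneous (local copy of `EinsteinProofs.trace_smul`). [folklore] -/
theorem trace_smul' {EB : Type*} [NormedAddCommGroup EB] [NormedSpace ℝ EB] {HB : Type*}
    [TopologicalSpace HB] {IB : ModelWithCorners ℝ EB HB} {B : Type*} [TopologicalSpace B]
    [ChartedSpace HB B] {nB : ℕ∞ω} {F : Type*} [NormedAddCommGroup F] [NormedSpace ℝ F]
    [FiniteDimensional ℝ F] {E : B → Type*} [TopologicalSpace (TotalSpace F E)]
    [∀ b, TopologicalSpace (E b)] [∀ b, AddCommGroup (E b)] [∀ b, Module ℝ (E b)] [FiberBundle F E]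
    [VectorBundle ℝ F E] (g : PseudoRiemannianMetric IB nB F E) (b : B) (a : ℝ)
    (T : LinearMap.BilinForm ℝ (E b)) :
    g.trace b (a • T) = a * g.trace b T := by
  simp only [PseudoRiemannianMetric.trace, LinearMap.comp_smul, map_smul, smul_eq_mul]

/-- **Rescaled null expansion**: under the hypotheses of
`secondFundamentalForm_of_eventuallyEq_smul`, `θ_ν(n) = A(n) θ_{L_s}(n)`. [cite: ONeill1983, Ch. 4, Lemma 4.18] -/
theorem nullExpansion_of_eventuallyEq_smul (D : SliceData V comp K dK W ℓ tc c)
    [(diagLorentz V comp hg h0 hpos4).toPseudoRiemannianMetric.HasLeviCivita]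
    (hpb : PseudoRiemannianMetric.contMDiff_pullbackBilin 𝓘(ℝ, E4) V (𝓡 2) (sphere (0 : E3) 1) ∞)
    (hf : (diagLorentz V comp hg h0 hpos4).toPseudoRiemannianMetric.IsSpacelikeImmersion (𝓡 2) D.f)
    (s : ℝ) (ν : NormalField 𝓘(ℝ, E4) D.f) (A : sphere (0 : E3) 1 → ℝ) (n : sphere (0 : E3) 1)
    (hν : MDifferentiableAt (𝓡 2) 𝓘(ℝ, E4) (fun y ↦ (ν y : E4)) n)
    (hA : MDifferentiableAt (𝓡 2) 𝓘(ℝ, ℝ) A n)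
    (heq : (fun y ↦ (ν y : E4)) =ᶠ[𝓝 n] fun y ↦ A y • (D.Lfield s y : E4)) :
    (diagLorentz V comp hg h0 hpos4).nullExpansion D.f hpb hf ν n =
      A n * (diagLorentz V comp hg h0 hpos4).nullExpansion D.f hpb hf (D.Lfield s) n := by
  rw [LorentzianMetric.nullExpansion, LorentzianMetric.nullExpansion,
    LorentzianMetric.nullSecondFundamentalForm_eq, LorentzianMetric.nullSecondFundamentalForm_eq,
    ← trace_smul']
  congr 1
  ext v w
  rw [LinearMap.smul_apply, LinearMap.smul_apply, smul_eq_mul]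
  exact D.secondFundamentalForm_of_eventuallyEq_smul s ν A n hν hA heq v w

/-- **Local form of an arbitrary null normal pair.** Near every point `n` of the sphere a null
normal pair `(L, L̲)` is `(A L_s, B L_{−s})` with `A, B` differentiable at `n` and
`A(n), B(n) > 0` (the sign `s` is locally constant by continuity of `G(L, L_{−s}) = −2A < 0`).
[cite: ONeill1983, Ch. 5, Lemma 5.26] -/
theorem pair_local (D : SliceData V comp K dK W ℓ tc c)
    (P : LorentzianMetric.NullNormalPair (𝓡 2) (diagLorentz V comp hg h0 hpos4)
      (diagTimeOrientation (hg := hg) (h0 := h0) (hpos := hpos4) (-1) (by norm_num)) D.f)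
    (n : sphere (0 : E3) 1) :
    ∃ s : ℝ, (s = 1 ∨ s = -1) ∧ ∃ A B : sphere (0 : E3) 1 → ℝ,
      0 < A n ∧ 0 < B n ∧ MDifferentiableAt (𝓡 2) 𝓘(ℝ, ℝ) A n ∧ MDifferentiableAt (𝓡 2) 𝓘(ℝ, ℝ) B n ∧
      ((fun y ↦ (P.L y : E4)) =ᶠ[𝓝 n] fun y ↦ A y • (D.Lfield s y : E4)) ∧
      ((fun y ↦ (P.Lbar y : E4)) =ᶠ[𝓝 n] fun y ↦ B y • (D.Lfield (-s) y : E4)) := by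
  haveI := factFinrankE3
  obtain ⟨s, hs, a, ha, hL, hLbar⟩ := D.pair_pointwise P n
  have hs2 : s * s = 1 := by rcases hs with rfl | rfl <;> norm_num
  -- the coefficient functions
  set A : sphere (0 : E3) 1 → ℝ := fun y ↦
    (-2⁻¹ : ℝ) * diagForm (kap K tc) (P.L y) (Lvec K tc (-s) y) with hAdef
  set B : sphere (0 : E3) 1 → ℝ := fun y ↦
    (-2⁻¹ : ℝ) * diagForm (kap K tc) (P.Lbar y) (Lvec K tc s y) with hBdef
  -- pointwise values through the classification
  have hkey : ∀ y : sphere (0 : E3) 1, ∀ s' a' : ℝ, (s' = 1 ∨ s' = -1) →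
      diagForm (kap K tc) (a' • Lvec K tc s' y) (Lvec K tc (-s) y) = a' * (-1 + s' * -s) := by
    intro y s' a' _
    rw [map_smul, FunLike.coe_smul, Pi.smul_apply, smul_eq_mul, Lvec, Lvec,
      diagForm_normal_normal D.kap_succ_pos _ _ _ _ (norm_eq_of_mem_sphere y) D.kap_zero_mul_L0_sq]
  have hkey' : ∀ y : sphere (0 : E3) 1, ∀ s' a' : ℝ, (s' = 1 ∨ s' = -1) →
      diagForm (kap K tc) (a' • Lvec K tc s' y) (Lvec K tc s y) = a' * (-1 + s' * s) := by
    intro y s' a' _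
    rw [map_smul, FunLike.coe_smul, Pi.smul_apply, smul_eq_mul, Lvec, Lvec,
      diagForm_normal_normal D.kap_succ_pos _ _ _ _ (norm_eq_of_mem_sphere y) D.kap_zero_mul_L0_sq]
  -- differentiability of `A`, `B`
  have hLv : ∀ s' : ℝ, MDifferentiable (𝓡 2) 𝓘(ℝ, E4) (fun y : sphere (0 : E3) 1 ↦ Lvec K tc s' y) :=
    fun s' ↦ (D.contMDiff_Lfield s' (m := 1)).mdifferentiable one_ne_zero
  have hAd : MDifferentiableAt (𝓡 2) 𝓘(ℝ, ℝ) A n :=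
    ((mdifferentiableAt_diagForm_apply (K := K) (tc := tc) (D.mdifferentiableAt_pair_L P n)
      (hLv (-s) n)).const_smul (-2⁻¹ : ℝ))
  have hBd : MDifferentiableAt (𝓡 2) 𝓘(ℝ, ℝ) B n :=
    ((mdifferentiableAt_diagForm_apply (K := K) (tc := tc) (D.mdifferentiableAt_pair_Lbar P n)
      (hLv s n)).const_smul (-2⁻¹ : ℝ))
  -- continuity of `φ = −2A`, negative at `n`
  have hφc : ContinuousAt (fun y : sphere (0 : E3) 1 ↦ diagForm (kap K tc) (P.L y) (Lvec K tc (-s) y)) n :=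
    (mdifferentiableAt_diagForm_apply (K := K) (tc := tc) (D.mdifferentiableAt_pair_L P n)
      (hLv (-s) n)).continuousAt
  have hφn : diagForm (kap K tc) (P.L n) (Lvec K tc (-s) n) < 0 := by
    rw [hL, hkey n s a hs]
    have : a * (-1 + s * -s) = -2 * a := by linear_combination (-a) * hs2
    rw [this]
    linarith
  have hev : ∀ᶠ y in 𝓝 n, diagForm (kap K tc) (P.L y) (Lvec K tc (-s) y) < 0 :=
    hφc.eventually (gt_mem_nhds hφn)
  -- on that neighbourhood the sign is `s` and the coefficients are `A`, `B`
  have hloc : ∀ y : sphere (0 : E3) 1, diagForm (kap K tc) (P.L y) (Lvec K tc (-s) y) < 0 →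
      (0 < A y ∧ 0 < B y) ∧
      (P.L y : E4) = A y • (D.Lfield s y : E4) ∧ (P.Lbar y : E4) = B y • (D.Lfield (-s) y : E4) := by
    intro y hy
    obtain ⟨s', hs', a', ha', hL', hLbar'⟩ := D.pair_pointwise P y
    have hss : s' = s := by
      rcases hs with rfl | rfl <;> rcases hs' with rfl | rfl
      · rfl
      · exfalso; rw [hL', hkey y (-1) a' (Or.inr rfl)] at hy; norm_num at hy
      · exfalso; rw [hL', hkey y 1 a' (Or.inl rfl)] at hy; norm_num at hy
      · rfl
    subst hss
    have hA : A y = a' := by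
      rw [hAdef]
      dsimp only
      rw [hL', hkey y s' a' hs]
      linear_combination (2⁻¹ * a') * hs2
    have hB : B y = a'⁻¹ := by
      rw [hBdef]
      dsimp only
      rw [hLbar', hkey' y (-s') a'⁻¹ (by rcases hs with rfl | rfl <;> norm_num)]
      linear_combination (2⁻¹ * a'⁻¹) * hs2
    exact ⟨⟨by rw [hA]; exact ha', by rw [hB]; exact inv_pos.mpr ha'⟩, by rw [hA]; exact hL',
      by rw [hB]; exact hLbar'⟩
  refine ⟨s, hs, A, B, (hloc n hφn).1.1, (hloc n hφn).1.2, hAd, hBd, ?_, ?_⟩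
  · filter_upwards [hev] with y hy using (hloc y hy).2.1
  · filter_upwards [hev] with y hy using (hloc y hy).2.2

/-- **The round `h`-sphere in a homogeneous slice is a closed trapped surface** as soon as
`4 √(−κ₀(t_c)) < ℓ · ∑ⱼ (κ̇ⱼ/κⱼ)(t_c)(1 − nⱼ²)` for all unit `n` (time orientation `−∂₀`): both
null expansions of every future null normal pair are negative at every point
(`θ_{aL_s} = a θ_{L_s}`, `θ_{L_±} = ±2/ℓ − ½(−κ₀)^{-1/2} m(n) < 0`). For the Kasner metric
`−dt² + ∑ t^{2pⱼ} dxʲ²` (`κ₀ = −1`, `κ̇ⱼ/κⱼ = 2pⱼ/t`, `m(n) = (2/t) ∑ pⱼ(1 − nⱼ²) ≥ (2/t)(1 − max pⱼ)`)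
this is the classical statement that the round spheres of radius `ℓ > 2t/(1 − max pⱼ)` in the
slices `t = const` are trapped towards the singularity (Hawking–Ellis 1973, §5.4 and §9.2;
Senovilla 2011, §5). [cite: HawkingEllis1973, §9.2] -/
theorem isTrappedSurface (D : SliceData V comp K dK W ℓ tc c)
    [(diagLorentz V comp hg h0 hpos4).toPseudoRiemannianMetric.HasLeviCivita]
    (htrap : ∀ n : E3, ‖n‖ = 1 → 4 * Real.sqrt (-K 0 tc) < ℓ * mfun K dK tc n) :
    (diagLorentz V comp hg h0 hpos4).IsTrappedSurface (𝓡 2)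
      (diagTimeOrientation (hg := hg) (h0 := h0) (hpos := hpos4) (-1) (by norm_num)) D.f := by
  haveI := factFinrankE3
  refine ⟨inferInstance, isSmoothEmbedding_sphereMap D.kap_succ_pos D.ℓ_pos.ne',
    PseudoRiemannianMetric.contMDiff_pullbackBilin_holds, D.isSpacelikeImmersion, ⟨D.nullNormalPair⟩,
    fun P n ↦ ?_⟩
  obtain ⟨s, hs, A, B, hA0, hB0, hAd, hBd, hLA, hLB⟩ := D.pair_local P n
  have hs' : -s = 1 ∨ -s = -1 := by rcases hs with rfl | rfl <;> norm_num
  constructor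
  · rw [D.nullExpansion_of_eventuallyEq_smul _ _ s P.L A n (D.mdifferentiableAt_pair_L P n) hAd hLA]
    exact mul_neg_of_pos_of_neg hA0
      (D.nullExpansion_Lfield_neg _ _ n (htrap n (norm_eq_of_mem_sphere n)) hs)
  · rw [D.nullExpansion_of_eventuallyEq_smul _ _ (-s) P.Lbar B n (D.mdifferentiableAt_pair_Lbar P n)
      hBd hLB]
    exact mul_neg_of_pos_of_neg hB0
      (D.nullExpansion_Lfield_neg _ _ n (htrap n (norm_eq_of_mem_sphere n)) hs')

end SliceData

end Kasner

end Literature.Geometry.Lorentzian
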